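import Literature.NumberTheory.LFunctions.BondarenkoHeap2026Sections3to5Proofs
import Literature.NumberTheory.LFunctions.BondarenkoHeap2026Numerics
import Literature.NumberTheory.Sieve.FouvryTenenbaumDivisorAPTuple
import Mathlib.Analysis.PSeries
import Mathlib.Data.Nat.Squarefree
import Mathlib.NumberTheory.ArithmeticFunction.Moebius
import Mathlib.MeasureTheory.Integral.IntervalIntegral.IntegrationByParts
import HarnessLib

/-!
# Bondarenko–Heap 2026: the diagonal computations — (15), (17), Theorem 3's diagonal, and the glue

LABEL (C5 / rh-crit-ah, LADDER-RH §4 HELD «conditional bridges: exceptional zero ⇒ …»):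
**NOT RH-BEARING.** RH-FREE literature (arXiv:2608.07399v1, §4 and §5): no `ζ` zeros, no
`RiemannHypothesis` binder except inside the quoted apex `bondarenkoHeap2026_theorem1`; nothing here
bears on the truth of RH. Companion of `BondarenkoHeap2026Sections3to5Proofs` (Lemma 4 ⇐ (14), (18),
Prop 5 ⇐ (17) + Prop 3), split off for size.

PROVED here:

* **(17)** (`eq17_holds : eq17`) — "for the inner sum, arguing as before we find
  `Σ_{m ⩽ L/p, (m,q)=1} G(m)G(pm)/m = C_G(log p/log L)(φ(q)/q) log L + O((log log q)²)`" (§5 p. 13),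
  along the §4 template the paper points to (p. 12, TeX l.566–580): "Inserting
  `1_{(n,q)=1} = Σ_{d|(n,q)} μ(d)` and writing `n = dm` … Replacing `f(dm)²` by `1` … is `O(1)`. Then by
  Euler–Maclaurin summation, the inner sum is `∫_1^{L/d} G₀(log dx/log L)² dx/x + O(1)` which … is
  `D_G log L + O(log d)`. Then since `Σ_{d|q} μ(d)/d = φ(q)/q` we acquire the main term. The total error
  is bounded by `Σ_{d|q}(1 + log d)/d ≪ Π_{p|q}(1 + 1/p)(1 + Σ_{p|q} log p/(p+1)) ≪ (log log q)²`":
  Möbius over `d ∣ q` (`sum_coprime_eq_sum_moebius`), `Σ_{d|q} μ(d)/d = φ(q)/q`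
  (the tree's `Sieve.FouvryTenenbaum2021.sum_divisors_moebius_div_real`), the inner sums against their integrals for a bounded Lipschitz
  profile (`sum_sub_integral_le`), the substitution `x = log(dt)/log L` (`integral_log_substitution`),
  the `O(log d)` end corrections (`inner_sum_estimate`), and the squarefree-divisor bound
  `Σ_{d|q} μ²(d)(1 + log d)/d ≤ 5e⁵ (log log q)²` for `q ≥ 27` (`sum_sqfree_divisors_log_le`, by the
  subset induction `powerset_log_sum_le`, `Π(1 + 1/p) ≤ exp Σ 1/p`, `Σ_{p|q} 1/p ≤ log log log q + 5`).
  Hence `prop5_of_prop3 : prop3 → prop5` and `theorem4_of_prop3_prop6 : prop3 → prop6 → theorem4`.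
* **The diagonal of `I₀`** (`diagonal_I0_estimate`): `Σ_{n ⩽ L, (n,q)=1} G(n)²/n =
  D_G (φ(q)/q) log L + O((log log q)²)` (§4 p. 12), by the same machinery with `u = 0`.
* **(15)** (`I0R_eq_sum`, `eq15`): "Opening the square and integrating,
  `I₀ = Σ_{m,n ⩽ L} χ(m)χ(n)G(m)G(n)/√(mn) Ŵ_T(log(n/m)/2π)`" (§4 p. 11): `|R(t)|²` as a double sum
  (`norm_dirichletPoly_sq`) and `∫ cos(tθ) W_T(t) dt = Ŵ_T(θ/2π)` (`integral_cos_mul_weight`, `W_T ∈ L¹`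
  by the sibling `Extension.integrable_weight`).
* **Theorem 3 ⇐ its off-diagonal estimate** (`theorem3_of_offDiagonal`): with (15), the diagonal and (3)
  proved, BH26:Thm3 is reduced to the printed off-diagonal claim (§4 p. 12, last display), taken as the
  explicit hypothesis `|offDiagI0| ≤ η S(q)` eventually (`offDiagI0` = the `m ≠ n` part of (15);
  `S(q) = Ŵ_T(0)(φ(q)/q) log L`); NO named fact is introduced. Bookkeeping corollary:
  `bondarenkoHeap2026_theorem1_of_leaves : proposition1 → (off-diagonal) → prop3 → prop6 →
  bondarenkoHeap2026_theorem1` (with the siblings' `extensionToLine_holds`, `numericalInequality8_holds`).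

## References

* [BondarenkoHeap2026] A. Bondarenko, W. Heap, arXiv:2608.07399v1: §4 (15) p. 11 and p. 12 (the
  diagonal of `I₀`, TeX l.556–580); §5 (17) p. 13; Theorem 3, Theorem 4, Proposition 5.
* [HardyWright2008] Thm 328 (`φ(n)/n ≫ 1/log log n`, tree `MertensBound.exists_lt_totient_div_self`),
  Thm 425/427 (Mertens, tree `MertensBound.sum_log_div_prime_le`, `MertensBound.sum_inv_prime_le`).
-/

noncomputable section

open Finset Real
open scoped ArithmeticFunction.Moebius

namespace Literature.NumberTheory.LFunctions.BondarenkoHeap2026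

/-! ### §5 (17) and the diagonal of `I₀` -/

section Eq17Proof

/-! ### Möbius: coprimality and `φ(q)/q` -/

/-- `∑_{d ∣ g} μ(d) = [g = 1]` (Mathlib's `μ * ζ = 1`). [folklore] -/
private theorem sum_divisors_moebius_real (g : ℕ) :
    ∑ d ∈ g.divisors, (μ d : ℝ) = if g = 1 then 1 else 0 := by
  have h := congrArg (fun f : ArithmeticFunction ℤ => f g) ArithmeticFunction.moebius_mul_coe_zeta
  simp only [ArithmeticFunction.coe_mul_zeta_apply, ArithmeticFunction.one_apply] at h
  have h' := congrArg (fun z : ℤ => (z : ℝ)) h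
  push_cast at h'
  rw [h']

/-- `1_{(m,q)=1} = ∑_{d ∣ q, d ∣ m} μ(d)` (`m, q ≥ 1`). [folklore] -/
private theorem ite_coprime_eq_sum_moebius' {m q : ℕ} (hm : m ≠ 0) (hq : q ≠ 0) :
    (if m.Coprime q then (1 : ℝ) else 0) = ∑ d ∈ q.divisors with d ∣ m, (μ d : ℝ) := by
  have hset : q.divisors.filter (fun d => d ∣ m) = (Nat.gcd m q).divisors := by
    ext d
    simp only [mem_filter, Nat.mem_divisors, Nat.dvd_gcd_iff]
    constructor
    · rintro ⟨⟨h1, -⟩, h2⟩; exact ⟨⟨h2, h1⟩, Nat.gcd_ne_zero_left hm⟩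
    · rintro ⟨⟨h2, h1⟩, -⟩; exact ⟨⟨h1, hq⟩, h2⟩
  rw [hset, sum_divisors_moebius_real]

/-- **Möbius over the divisors of `q`**: `∑_{m ⩽ n, (m,q)=1} a(m) = ∑_{d ∣ q} μ(d) ∑_{k ⩽ n/d} a(dk)`.
[cite: BondarenkoHeap2026, §4 p. 12 ("Inserting 1_{(n,q)=1} = Σ_{d|(n,q)} μ(d) and writing n = dm")] -/
theorem sum_coprime_eq_sum_moebius {q : ℕ} (hq : q ≠ 0) (a : ℕ → ℝ) (n : ℕ) :
    ∑ m ∈ (Icc 1 n).filter (fun m => Nat.Coprime m q), a m =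
      ∑ d ∈ q.divisors, (μ d : ℝ) * ∑ k ∈ Icc 1 (n / d), a (d * k) := by
  classical
  rw [sum_filter]
  have h1 : ∀ m ∈ Icc 1 n, (if m.Coprime q then a m else 0) =
      ∑ d ∈ q.divisors, if d ∣ m then (μ d : ℝ) * a m else 0 := by
    intro m hm
    have hm0 : m ≠ 0 := by have := (mem_Icc.mp hm).1; omega
    rw [← sum_filter, ← sum_mul, ← ite_coprime_eq_sum_moebius' hm0 hq]
    split_ifs <;> simp
  rw [sum_congr rfl h1, sum_comm]
  refine sum_congr rfl fun d hd => ?_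
  have hd1 : 1 ≤ d := Nat.pos_of_mem_divisors hd
  rw [mul_sum]
  have := sum_Icc_ite_dvd_eq' (fun m => (μ d : ℝ) * a m) hd1 n
  exact this
where
  /-- helper: multiples of `d` in `[1, n]`. [folklore] -/
  sum_Icc_ite_dvd_eq' (f : ℕ → ℝ) {m : ℕ} (hm : 1 ≤ m) (N : ℕ) :
      ∑ n ∈ Icc 1 N, (if m ∣ n then f n else 0) = ∑ k ∈ Icc 1 (N / m), f (m * k) := by
    rw [← sum_filter]
    have himg : (Icc 1 N).filter (fun n => m ∣ n) = (Icc 1 (N / m)).image (fun k => m * k) := by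
      ext n
      simp only [mem_filter, mem_Icc, mem_image]
      constructor
      · rintro ⟨⟨h1, h2⟩, ⟨k, rfl⟩⟩
        refine ⟨k, ⟨?_, ?_⟩, rfl⟩
        · rcases Nat.eq_zero_or_pos k with hk | hk
          · subst hk; simp at h1
          · exact hk
        · exact (Nat.le_div_iff_mul_le hm).mpr (by rw [Nat.mul_comm]; exact h2)
      · rintro ⟨k, ⟨h1, h2⟩, rfl⟩
        refine ⟨⟨?_, ?_⟩, dvd_mul_right _ _⟩
        · exact le_trans hm (Nat.le_mul_of_pos_right _ h1)
        · have := (Nat.le_div_iff_mul_le hm).mp h2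
          rw [Nat.mul_comm]; exact this
    rw [himg, sum_image]
    intro a _ b _ hab
    exact Nat.eq_of_mul_eq_mul_left hm hab

/-! ### The squarefree-divisor sum `Σ_{d | q} μ²(d)(1 + log d)/d ≪ (log log q)²` -/

/-- The induction behind `Σ_{d|q} μ²(d)(1+log d)/d ≤ Π_{p|q}(1+1/p)·(1 + Σ_{p|q} log p/p)`:
for a finite set `P` of naturals `≥ 1`,
`Σ_{t ⊆ P} (1 + Σ_{p∈t} log p) Π_{p∈t} p⁻¹ ≤ (Σ_{t ⊆ P} Π_{p∈t} p⁻¹)(1 + Σ_{p ∈ P} log p/p)`.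
[cite: BondarenkoHeap2026, §4 p. 12 ("The total error is bounded by Σ_{d|q}(1+log d)/d ≪ Π(1+1/p)(1+Σ log p/(p+1))")] -/
theorem powerset_log_sum_le (P : Finset ℕ) (hP : ∀ p ∈ P, 1 ≤ p) :
    ∑ t ∈ P.powerset, (1 + ∑ p ∈ t, Real.log p) * ∏ p ∈ t, (1 / (p : ℝ)) ≤
      (∑ t ∈ P.powerset, ∏ p ∈ t, (1 / (p : ℝ))) * (1 + ∑ p ∈ P, Real.log p / p) := by
  classical
  induction P using Finset.induction_on with
  | empty => simp
  | @insert a s ha ih =>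
    have hP' : ∀ p ∈ s, 1 ≤ p := fun p hp => hP p (mem_insert_of_mem hp)
    have ha1 : 1 ≤ a := hP a (mem_insert_self a s)
    have ha0 : (0 : ℝ) < a := by exact_mod_cast ha1
    have hloga : 0 ≤ Real.log a := Real.log_nonneg (by exact_mod_cast ha1)
    have IH := ih hP'
    set Ss := ∑ t ∈ s.powerset, (1 + ∑ p ∈ t, Real.log p) * ∏ p ∈ t, (1 / (p : ℝ)) with hSs
    set Bs := ∑ t ∈ s.powerset, ∏ p ∈ t, (1 / (p : ℝ)) with hBs
    set As := ∑ p ∈ s, Real.log p / p with hAs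
    have hnot : ∀ t ∈ s.powerset, a ∉ t := fun t ht h => ha (mem_powerset.mp ht h)
    have h1 : ∑ t ∈ (insert a s).powerset, (1 + ∑ p ∈ t, Real.log p) * ∏ p ∈ t, (1 / (p : ℝ)) =
        Ss + (1 / a) * Ss + (Real.log a / a) * Bs := by
      rw [sum_powerset_insert ha]
      have : ∀ t ∈ s.powerset, (1 + ∑ p ∈ insert a t, Real.log p) * ∏ p ∈ insert a t, (1 / (p : ℝ)) =
          (1 / a) * ((1 + ∑ p ∈ t, Real.log p) * ∏ p ∈ t, (1 / (p : ℝ))) +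
            (Real.log a / a) * ∏ p ∈ t, (1 / (p : ℝ)) := by
        intro t ht
        rw [sum_insert (hnot t ht), prod_insert (hnot t ht)]
        ring
      rw [sum_congr rfl this, sum_add_distrib, ← mul_sum, ← mul_sum]
      ring
    have h2 : ∑ t ∈ (insert a s).powerset, ∏ p ∈ t, (1 / (p : ℝ)) = Bs + (1 / a) * Bs := by
      rw [sum_powerset_insert ha]
      have : ∀ t ∈ s.powerset, ∏ p ∈ insert a t, (1 / (p : ℝ)) = (1 / a) * ∏ p ∈ t, (1 / (p : ℝ)) := by
        intro t ht; rw [prod_insert (hnot t ht)]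
      rw [sum_congr rfl this, ← mul_sum]
    have h3 : ∑ p ∈ insert a s, Real.log p / p = As + Real.log a / a := by
      rw [sum_insert ha]; ring
    rw [h1, h2, h3]
    have hBs0 : 0 ≤ Bs := sum_nonneg fun t _ => prod_nonneg fun p _ => by positivity
    have hAs0 : 0 ≤ As := sum_nonneg fun p hp =>
      div_nonneg (Real.log_nonneg (by exact_mod_cast hP' p hp)) (Nat.cast_nonneg _)
    have hia : 0 ≤ 1 / (a : ℝ) := by positivity
    have hla : 0 ≤ Real.log a / a := by positivity
    -- Ss + Ss/a + (log a/a) Bs ≤ (Bs + Bs/a)(1 + As + log a/a)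
    have e1 : (1 / (a : ℝ)) * Ss ≤ (1 / a) * (Bs * (1 + As)) := mul_le_mul_of_nonneg_left IH hia
    have e2 : 0 ≤ (1 / (a : ℝ)) * Bs * (Real.log a / a) := by positivity
    nlinarith [IH, e1, e2, hBs0, hAs0, hla, hia]

/-- The squarefree-divisor sum as a sum over subsets of the prime factors.
[folklore] -/
private theorem sum_sqfree_divisors_eq_powerset {q : ℕ} (hq : q ≠ 0) (F : ℕ → ℝ) :
    ∑ d ∈ q.divisors with Squarefree d, F d = ∑ t ∈ q.primeFactors.powerset, F (∏ p ∈ t, p) := by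
  rw [Nat.sum_divisors_filter_squarefree hq]
  have hfac : (UniqueFactorizationMonoid.normalizedFactors q).toFinset = q.primeFactors := by
    rw [Nat.factors_eq]; rfl
  rw [hfac]
  refine sum_congr rfl fun t _ => ?_
  congr 1
  rw [Finset.prod_eq_multiset_prod, Multiset.map_id']

/-- `Σ_{t ⊆ P} Π_{p ∈ t} 1/p = Π_{p ∈ P} (1 + 1/p) ≤ exp(Σ_{p∈P} 1/p)`. [folklore] -/
private theorem powerset_prod_inv_le_exp (P : Finset ℕ) :
    ∑ t ∈ P.powerset, ∏ p ∈ t, (1 / (p : ℝ)) ≤ Real.exp (∑ p ∈ P, 1 / (p : ℝ)) := by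
  rw [← prod_one_add, Real.exp_sum]
  refine prod_le_prod (fun p _ => by positivity) fun p _ => ?_
  have := Real.add_one_le_exp (1 / (p : ℝ))
  linarith

/-- `Σ_{p | q} 1/p ≤ log log log q + 5` for `q ≥ 27` (split at `y = log q`: Mertens' `Σ_{p ≤ y} 1/p
≤ log log y + 4`, and at most `log q/log y` prime factors exceed `y`). [folklore] -/
private theorem sum_primeFactors_inv_le {q : ℕ} (hq : 27 ≤ q) :
    ∑ p ∈ q.primeFactors, 1 / (p : ℝ) ≤ Real.log (Real.log (Real.log q)) + 5 := by
  classical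
  have hq0 : (0 : ℝ) < q := by exact_mod_cast (show 0 < q by omega)
  have hq27 : (27 : ℝ) ≤ q := by exact_mod_cast hq
  set y := Real.log q with hy
  -- `y ≥ log 27 > 3`
  have hy3 : 3 < y := by
    rw [hy]
    have h27 : Real.log 27 = 3 * Real.log 3 := by
      rw [show (27 : ℝ) = 3 ^ 3 by norm_num, Real.log_pow]; norm_num
    have := MertensBound.one_lt_log_three
    calc (3 : ℝ) < 3 * Real.log 3 := by linarith
      _ = Real.log 27 := h27.symm
      _ ≤ Real.log q := Real.log_le_log (by norm_num) hq27
  have hy0 : 0 < y := by linarith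
  have hlogy1 : 1 ≤ Real.log y := by
    rw [Real.le_log_iff_exp_le hy0]
    exact (Real.exp_one_lt_d9.le.trans (by norm_num)).trans hy3.le
  set Y := ⌊y⌋₊ with hY
  have hY3 : 3 ≤ Y := by rw [hY]; exact Nat.le_floor (by exact_mod_cast hy3.le)
  have hYy : (Y : ℝ) ≤ y := Nat.floor_le hy0.le
  have hY0 : (0 : ℝ) < Y := by exact_mod_cast (show 0 < Y by omega)
  rw [← sum_filter_add_sum_filter_not q.primeFactors (fun p => p ≤ Y)]
  -- small primes
  have hsmall : ∑ p ∈ q.primeFactors.filter (fun p => p ≤ Y), 1 / (p : ℝ) ≤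
      Real.log (Real.log (Real.log q)) + 4 := by
    have hsub : q.primeFactors.filter (fun p => p ≤ Y) ⊆ Nat.primesLE Y := by
      intro p hp
      rw [mem_filter] at hp
      exact Nat.mem_primesLE.mpr ⟨hp.2, Nat.prime_of_mem_primeFactors hp.1⟩
    calc ∑ p ∈ q.primeFactors.filter (fun p => p ≤ Y), 1 / (p : ℝ)
        ≤ ∑ p ∈ Nat.primesLE Y, 1 / (p : ℝ) :=
          sum_le_sum_of_subset_of_nonneg hsub fun p _ _ => by positivity
      _ ≤ Real.log (Real.log Y) + 4 := MertensBound.sum_inv_prime_le Y (by omega)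
      _ ≤ Real.log (Real.log y) + 4 := by
          have h1 : Real.log Y ≤ Real.log y := Real.log_le_log hY0 hYy
          have h2 : 0 < Real.log Y := Real.log_pos (by exact_mod_cast (show 1 < Y by omega))
          linarith [Real.log_le_log h2 h1]
  -- large primes
  have hlarge : ∑ p ∈ q.primeFactors.filter (fun p => ¬ p ≤ Y), 1 / (p : ℝ) ≤ 1 := by
    set Pl := q.primeFactors.filter (fun p => ¬ p ≤ Y) with hPl
    have hmem : ∀ p ∈ Pl, y < p := by
      intro p hp
      rw [hPl, mem_filter, not_le] at hp
      exact Nat.lt_of_floor_lt hp.2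
    have hcard : (Pl.card : ℝ) * Real.log y ≤ y := by
      calc (Pl.card : ℝ) * Real.log y = ∑ p ∈ Pl, Real.log y := by rw [sum_const]; simp
        _ ≤ ∑ p ∈ Pl, Real.log p :=
            sum_le_sum fun p hp => Real.log_le_log hy0 (hmem p hp).le
        _ ≤ ∑ p ∈ q.primeFactors, Real.log p := by
            refine sum_le_sum_of_subset_of_nonneg (filter_subset _ _) fun p hp _ => ?_
            exact Real.log_nonneg (by exact_mod_cast (Nat.prime_of_mem_primeFactors hp).one_lt.le)
        _ = Real.log (∏ p ∈ q.primeFactors, (p : ℝ)) := by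
            rw [Real.log_prod]; intro p hp
            exact_mod_cast (Nat.prime_of_mem_primeFactors hp).ne_zero
        _ ≤ y := by
            rw [hy]
            have hdvd := Nat.prod_primeFactors_dvd q
            have hle : ((∏ p ∈ q.primeFactors, p : ℕ) : ℝ) ≤ q := by
              exact_mod_cast Nat.le_of_dvd (by omega) hdvd
            have hpos : (0 : ℝ) < ((∏ p ∈ q.primeFactors, p : ℕ) : ℝ) := by
              have : 0 < ∏ p ∈ q.primeFactors, p :=
                prod_pos fun p hp => (Nat.prime_of_mem_primeFactors hp).pos
              exact_mod_cast this
            push_cast at hle hpos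
            exact Real.log_le_log hpos hle
    calc ∑ p ∈ Pl, 1 / (p : ℝ) ≤ ∑ p ∈ Pl, 1 / y :=
          sum_le_sum fun p hp => by
            have hp0 : (0 : ℝ) < p := lt_trans hy0 (hmem p hp)
            exact one_div_le_one_div_of_le hy0 (hmem p hp).le
      _ = Pl.card * (1 / y) := by rw [sum_const]; simp
      _ ≤ (y / Real.log y) * (1 / y) := by
          refine mul_le_mul_of_nonneg_right ?_ (by positivity)
          rw [le_div_iff₀ (by linarith)]; exact hcard
      _ = 1 / Real.log y := by field_simp
      _ ≤ 1 := by rw [div_le_one (by linarith)]; exact hlogy1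
  linarith

/-- **Primes dividing `q`**: for `S ⊆ {p ∣ q}`, `q ≥ 3`, `Σ_{p∈S} log p/p ≤ log log q + log 4 + 1`
(private copy of the lemma of `BondarenkoHeap2026Sections3to5Proofs`). [folklore] -/
private theorem sum_log_div_le_of_subset_primeFactors {q : ℕ} (hq : 3 ≤ q) {S : Finset ℕ}
    (hS : S ⊆ q.primeFactors) :
    ∑ p ∈ S, Real.log p / p ≤ Real.log (Real.log q) + Real.log 4 + 1 := by
  have hq0 : (0 : ℝ) < q := by exact_mod_cast (show 0 < q by omega)
  have hq3 : (3 : ℝ) ≤ q := by exact_mod_cast hq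
  set y : ℝ := Real.log q with hy
  have hy1 : 1 < y := by
    rw [hy]
    have : Real.log 3 ≤ Real.log q := Real.log_le_log (by norm_num) hq3
    linarith [MertensBound.one_lt_log_three]
  have hy0 : 0 < y := by linarith
  classical
  rw [← sum_filter_add_sum_filter_not S (fun p => p ≤ ⌊y⌋₊)]
  have hsmall : ∑ p ∈ S.filter (fun p => p ≤ ⌊y⌋₊), Real.log p / p ≤ Real.log y + Real.log 4 := by
    have hsub : S.filter (fun p => p ≤ ⌊y⌋₊) ⊆ Nat.primesLE ⌊y⌋₊ := by
      intro p hp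
      rw [mem_filter] at hp
      exact Nat.mem_primesLE.mpr ⟨hp.2, Nat.prime_of_mem_primeFactors (hS hp.1)⟩
    have hfl1 : 1 ≤ ⌊y⌋₊ := Nat.one_le_floor_iff _ |>.mpr hy1.le
    have hfl0 : (0 : ℝ) < ⌊y⌋₊ := by exact_mod_cast hfl1
    calc ∑ p ∈ S.filter (fun p => p ≤ ⌊y⌋₊), Real.log p / p
        ≤ ∑ p ∈ Nat.primesLE ⌊y⌋₊, Real.log p / p := by
          refine sum_le_sum_of_subset_of_nonneg hsub fun p hp _ => ?_
          have := (Nat.mem_primesLE.mp hp).2.one_lt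
          exact div_nonneg (Real.log_nonneg (by exact_mod_cast this.le)) (Nat.cast_nonneg _)
      _ ≤ Real.log ⌊y⌋₊ + Real.log 4 := MertensBound.sum_log_div_prime_le _
      _ ≤ Real.log y + Real.log 4 := by
          have := Real.log_le_log hfl0 (Nat.floor_le hy0.le)
          linarith
  have hlarge : ∑ p ∈ S.filter (fun p => ¬ p ≤ ⌊y⌋₊), Real.log p / p ≤ 1 := by
    have hstep : ∀ p ∈ S.filter (fun p => ¬ p ≤ ⌊y⌋₊), Real.log p / p ≤ Real.log p / y := by
      intro p hp
      rw [mem_filter, not_le] at hp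
      have hpy : y ≤ p := (Nat.lt_of_floor_lt hp.2).le
      have hp1 := (Nat.prime_of_mem_primeFactors (hS hp.1)).one_lt
      exact div_le_div_of_nonneg_left (Real.log_nonneg (by exact_mod_cast hp1.le)) hy0 hpy
    have hsumlog : ∑ p ∈ S.filter (fun p => ¬ p ≤ ⌊y⌋₊), Real.log p ≤ y := by
      have hsub : S.filter (fun p => ¬ p ≤ ⌊y⌋₊) ⊆ q.primeFactors :=
        (filter_subset _ _).trans hS
      calc ∑ p ∈ S.filter (fun p => ¬ p ≤ ⌊y⌋₊), Real.log p
          ≤ ∑ p ∈ q.primeFactors, Real.log p := by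
            refine sum_le_sum_of_subset_of_nonneg hsub fun p hp _ => ?_
            exact Real.log_nonneg (by exact_mod_cast (Nat.prime_of_mem_primeFactors hp).one_lt.le)
        _ = Real.log (∏ p ∈ q.primeFactors, (p : ℝ)) := by
            rw [Real.log_prod]
            intro p hp
            exact_mod_cast (Nat.prime_of_mem_primeFactors hp).ne_zero
        _ ≤ y := by
            rw [hy]
            have hdvd := Nat.prod_primeFactors_dvd q
            have hle : ((∏ p ∈ q.primeFactors, p : ℕ) : ℝ) ≤ q := by
              exact_mod_cast Nat.le_of_dvd (by omega) hdvd
            have hpos : (0 : ℝ) < ((∏ p ∈ q.primeFactors, p : ℕ) : ℝ) := by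
              have : 0 < ∏ p ∈ q.primeFactors, p :=
                prod_pos fun p hp => (Nat.prime_of_mem_primeFactors hp).pos
              exact_mod_cast this
            push_cast at hle hpos
            exact Real.log_le_log hpos hle
    calc ∑ p ∈ S.filter (fun p => ¬ p ≤ ⌊y⌋₊), Real.log p / p
        ≤ ∑ p ∈ S.filter (fun p => ¬ p ≤ ⌊y⌋₊), Real.log p / y := sum_le_sum hstep
      _ = (∑ p ∈ S.filter (fun p => ¬ p ≤ ⌊y⌋₊), Real.log p) / y := by rw [sum_div]
      _ ≤ y / y := div_le_div_of_nonneg_right hsumlog hy0.le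
      _ = 1 := div_self hy0.ne'
  have hlogy : Real.log y = Real.log (Real.log q) := by rw [hy]
  linarith

/-- **`Σ_{d ∣ q} μ²(d)(1 + log d)/d ≪ (log log q)²`** (§4 p. 12: "`≪ Π_{p|q}(1+1/p)(1 + Σ_{p|q} log p/(p+1))
≪ (log log q)²`"), here with the explicit constant `5e⁵` for `q ≥ 27`.
[cite: BondarenkoHeap2026, §4 p. 12 (total error ≪ (log log q)²)] -/
theorem sum_sqfree_divisors_log_le {q : ℕ} (hq : 27 ≤ q) :
    ∑ d ∈ q.divisors with Squarefree d, (1 + Real.log d) / d ≤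
      5 * Real.exp 5 * Real.log (Real.log q) ^ 2 := by
  have hq0 : q ≠ 0 := by omega
  have hq0r : (0 : ℝ) < q := by exact_mod_cast (show 0 < q by omega)
  set ll := Real.log (Real.log q) with hll
  -- `ll ≥ 1` : `log q ≥ log 27 > 3 > e`
  have hlogq3 : 3 < Real.log q := by
    have h27 : Real.log 27 = 3 * Real.log 3 := by
      rw [show (27 : ℝ) = 3 ^ 3 by norm_num, Real.log_pow]; norm_num
    have := MertensBound.one_lt_log_three
    calc (3 : ℝ) < 3 * Real.log 3 := by linarith
      _ = Real.log 27 := h27.symm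
      _ ≤ Real.log q := Real.log_le_log (by norm_num) (by exact_mod_cast hq)
  have hll1 : 1 ≤ ll := by
    rw [hll, Real.le_log_iff_exp_le (by linarith)]
    exact (Real.exp_one_lt_d9.le.trans (by norm_num)).trans hlogq3.le
  have hll0 : 0 < ll := by linarith
  -- rewrite as a sum over subsets of the prime factors
  have hP1 : ∀ p ∈ q.primeFactors, 1 ≤ p := fun p hp => (Nat.prime_of_mem_primeFactors hp).one_lt.le
  have hrew : ∑ d ∈ q.divisors with Squarefree d, (1 + Real.log d) / d =
      ∑ t ∈ q.primeFactors.powerset, (1 + ∑ p ∈ t, Real.log p) * ∏ p ∈ t, (1 / (p : ℝ)) := by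
    rw [sum_sqfree_divisors_eq_powerset hq0]
    refine sum_congr rfl fun t ht => ?_
    have ht' : ∀ p ∈ t, (p : ℝ) ≠ 0 := fun p hp => by
      have := hP1 p (mem_powerset.mp ht hp); exact_mod_cast (by omega : p ≠ 0)
    rw [Nat.cast_prod, Real.log_prod ht', div_eq_mul_one_div, one_div, ← prod_inv_distrib]
    simp only [one_div]
  rw [hrew]
  have h1 := powerset_log_sum_le q.primeFactors hP1
  have h2 := powerset_prod_inv_le_exp q.primeFactors
  have h3 := sum_primeFactors_inv_le hq
  have h4 : ∑ p ∈ q.primeFactors, Real.log p / p ≤ ll + Real.log 4 + 1 :=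
    sum_log_div_le_of_subset_primeFactors (by omega) (subset_refl _)
  have hlog4 : Real.log 4 ≤ 2 := by
    have : Real.log 4 = 2 * Real.log 2 := by
      rw [show (4 : ℝ) = 2 ^ 2 by norm_num, Real.log_pow]; norm_num
    rw [this]
    have := Real.log_two_lt_d9
    linarith
  have hB : ∑ t ∈ q.primeFactors.powerset, ∏ p ∈ t, (1 / (p : ℝ)) ≤ Real.exp 5 * ll := by
    refine h2.trans ?_
    calc Real.exp (∑ p ∈ q.primeFactors, 1 / (p : ℝ)) ≤ Real.exp (Real.log ll + 5) :=
          Real.exp_le_exp.mpr h3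
      _ = Real.exp 5 * ll := by rw [Real.exp_add, Real.exp_log hll0, mul_comm]
  have hB0 : 0 ≤ ∑ t ∈ q.primeFactors.powerset, ∏ p ∈ t, (1 / (p : ℝ)) :=
    sum_nonneg fun t _ => prod_nonneg fun p _ => by positivity
  have hA0 : 0 ≤ 1 + ∑ p ∈ q.primeFactors, Real.log p / p := by
    have : 0 ≤ ∑ p ∈ q.primeFactors, Real.log p / p := sum_nonneg fun p hp =>
      div_nonneg (Real.log_nonneg (by exact_mod_cast hP1 p hp)) (Nat.cast_nonneg _)
    linarith
  calc _ ≤ (∑ t ∈ q.primeFactors.powerset, ∏ p ∈ t, (1 / (p : ℝ))) *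
        (1 + ∑ p ∈ q.primeFactors, Real.log p / p) := h1
    _ ≤ (Real.exp 5 * ll) * (ll + 4) := by
        refine mul_le_mul hB (by linarith) hA0 (by positivity)
    _ ≤ (Real.exp 5 * ll) * (5 * ll) := by
        refine mul_le_mul_of_nonneg_left (by linarith) (by positivity)
    _ = 5 * Real.exp 5 * ll ^ 2 := by ring

/-! ### Euler–Maclaurin for the inner sums: sum versus integral for a Lipschitz profile -/

/-- `Σ_{k=1}^{n} 1/k² ≤ 2`. [folklore] -/
private theorem sum_Icc_inv_sq_le_two (n : ℕ) : ∑ k ∈ Icc 1 n, 1 / ((k : ℝ) ^ 2) ≤ 2 := by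
  have h := sum_Ioo_inv_sq_le (α := ℝ) 0 (n + 1)
  have hset : Ioo 0 (n + 1) = Icc 1 n := by ext k; simp only [mem_Ioo, mem_Icc]; omega
  rw [hset] at h
  simp only [one_div, Nat.cast_zero, zero_add, div_one] at h ⊢
  exact h

/-- **Sum versus integral** for `h(t) = ψ(log(dt)/κ)/t`, `ψ` bounded by `B` and `Λ`-Lipschitz,
`κ ≥ 1`, `d ≥ 1`: `|Σ_{k=1}^{n} h(k) − ∫_1^{n+1} h| ≤ 2(Λ + B)` (the term `k` against `∫_k^{k+1}`:
`|h(k) − h(t)| ≤ (Λ + B)/k²` for `t ∈ [k, k+1]`). This is the "Euler–Maclaurin summation" step of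
§4 (p. 12) in Lipschitz form. [cite: BondarenkoHeap2026, §4 p. 12 ("Then by Euler–Maclaurin summation, the inner sum is ∫ … + O(1)")] -/
theorem sum_sub_integral_le {ψ : ℝ → ℝ} {B Λ : ℝ} (hB0 : 0 ≤ B) (hΛ0 : 0 ≤ Λ)
    (hB : ∀ x, |ψ x| ≤ B) (hΛ : ∀ x y, |ψ x - ψ y| ≤ Λ * |x - y|) (hψc : Continuous ψ)
    {κ : ℝ} (hκ : 1 ≤ κ) {d : ℝ} (hd : 1 ≤ d) (n : ℕ) :
    |∑ k ∈ Icc 1 n, ψ (Real.log (d * k) / κ) / k -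
        ∫ t in (1 : ℝ)..((n : ℝ) + 1), ψ (Real.log (d * t) / κ) / t| ≤ 2 * (Λ + B) := by
  have hκ0 : 0 < κ := by linarith
  have hd0 : 0 < d := by linarith
  set h : ℝ → ℝ := fun t => ψ (Real.log (d * t) / κ) / t with hh
  -- continuity on `[a, b] ⊂ (0, ∞)`
  have hcont : ∀ a b : ℝ, 0 < a → a ≤ b → ContinuousOn h (Set.uIcc a b) := by
    intro a b ha hab
    rw [Set.uIcc_of_le hab]
    have hne : ∀ t ∈ Set.Icc a b, t ≠ 0 := fun t ht => by linarith [ht.1]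
    refine ContinuousOn.div ?_ continuousOn_id hne
    refine hψc.comp_continuousOn ((ContinuousOn.div_const ?_ κ))
    refine (Real.continuousOn_log.comp (continuous_const.mul continuous_id).continuousOn ?_)
    intro t ht
    simp only [Set.mem_compl_iff, Set.mem_singleton_iff]
    exact mul_ne_zero hd0.ne' (hne t ht)
  have hii : ∀ k : ℕ, 1 ≤ k → IntervalIntegrable h MeasureTheory.volume (k : ℝ) ((k : ℝ) + 1) := by
    intro k hk
    have hk0 : (0 : ℝ) < k := by exact_mod_cast hk
    exact (hcont k (k + 1) hk0 (by linarith)).intervalIntegrable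
  -- the integral as a sum of unit-interval integrals
  have hsplit : ∫ t in (1 : ℝ)..((n : ℝ) + 1), h t = ∑ k ∈ Icc 1 n, ∫ t in (k : ℝ)..((k : ℝ) + 1), h t := by
    have := intervalIntegral.sum_integral_adjacent_intervals (a := fun k : ℕ => ((k : ℝ) + 1))
      (f := h) (n := n) (fun k _ => by
        have := hii (k + 1) (by omega)
        push_cast at this ⊢
        simpa [add_assoc] using this)
    simp only [Nat.cast_zero, zero_add] at this
    rw [← this, ← Finset.Ico_add_one_right_eq_Icc, Finset.sum_Ico_eq_sum_range]
    simp only [add_tsub_cancel_right, Nat.cast_add, Nat.cast_one]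
    exact sum_congr rfl fun k _ => by rw [add_comm (1 : ℝ) (k : ℝ)]
  -- termwise
  have hterm : ∀ k ∈ Icc 1 n, |h k - ∫ t in (k : ℝ)..((k : ℝ) + 1), h t| ≤ (Λ + B) * (1 / (k : ℝ) ^ 2) := by
    intro k hk
    have hk1 : (1 : ℝ) ≤ k := by exact_mod_cast (mem_Icc.mp hk).1
    have hk0 : (0 : ℝ) < k := by linarith
    have hconst : ∫ _ in (k : ℝ)..((k : ℝ) + 1), h k = h k := by
      rw [intervalIntegral.integral_const]; simp
    have hdiff : h k - ∫ t in (k : ℝ)..((k : ℝ) + 1), h t =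
        ∫ t in (k : ℝ)..((k : ℝ) + 1), (h k - h t) := by
      rw [intervalIntegral.integral_sub intervalIntegrable_const (hii k (mem_Icc.mp hk).1), hconst]
    rw [hdiff]
    have hbound : ∀ t ∈ Set.uIoc (k : ℝ) ((k : ℝ) + 1), ‖h k - h t‖ ≤ (Λ + B) * (1 / (k : ℝ) ^ 2) := by
      intro t ht
      rw [Set.uIoc_of_le (by linarith)] at ht
      have ht0 : 0 < t := by linarith [ht.1]
      have htk : (k : ℝ) ≤ t := ht.1.le
      rw [Real.norm_eq_abs]
      -- h k − h t = (ψ x_k − ψ x_t)/t + ψ x_k (1/k − 1/t)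
      have hxdiff : |Real.log (d * k) / κ - Real.log (d * t) / κ| ≤ 1 / k := by
        rw [← sub_div, abs_div, abs_of_pos hκ0, Real.log_mul hd0.ne' hk0.ne',
          Real.log_mul hd0.ne' ht0.ne', show Real.log d + Real.log k - (Real.log d + Real.log t) =
            -(Real.log t - Real.log k) by ring, abs_neg, ← Real.log_div ht0.ne' hk0.ne']
        have hlog0 : 0 ≤ Real.log (t / k) := Real.log_nonneg ((one_le_div hk0).mpr htk)
        rw [abs_of_nonneg hlog0, div_le_iff₀ hκ0]
        have h1 : Real.log (t / k) ≤ t / k - 1 := Real.log_le_sub_one_of_pos (by positivity)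
        have h2 : t / k - 1 ≤ 1 / k := by
          rw [div_sub_one hk0.ne']
          exact div_le_div_of_nonneg_right (by linarith [ht.2]) hk0.le
        calc Real.log (t / k) ≤ 1 / k := h1.trans h2
          _ ≤ 1 / k * κ := by nlinarith [one_div_pos.mpr hk0]
      have e : h k - h t = (ψ (Real.log (d * k) / κ) - ψ (Real.log (d * t) / κ)) / t +
          ψ (Real.log (d * k) / κ) * (1 / k - 1 / t) := by
        simp only [hh]; field_simp; ring
      rw [e]
      have hA : |(ψ (Real.log (d * k) / κ) - ψ (Real.log (d * t) / κ)) / t| ≤ Λ * (1 / k) / k := by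
        rw [abs_div, abs_of_pos ht0]
        calc |ψ (Real.log (d * k) / κ) - ψ (Real.log (d * t) / κ)| / t
            ≤ Λ * (1 / k) / t := by
              refine div_le_div_of_nonneg_right ?_ ht0.le
              exact (hΛ _ _).trans (mul_le_mul_of_nonneg_left hxdiff hΛ0)
          _ ≤ Λ * (1 / k) / k := div_le_div_of_nonneg_left (by positivity) hk0 htk
      have hB' : |ψ (Real.log (d * k) / κ) * (1 / k - 1 / t)| ≤ B * (1 / k ^ 2) := by
        rw [abs_mul]
        have h1 : |1 / (k : ℝ) - 1 / t| ≤ 1 / k ^ 2 := by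
          have hnn : 0 ≤ 1 / (k : ℝ) - 1 / t := by
            rw [sub_nonneg]; exact one_div_le_one_div_of_le hk0 htk
          rw [abs_of_nonneg hnn]
          have : 1 / (k : ℝ) - 1 / t = (t - k) / (k * t) := by field_simp
          rw [this]
          have e1 : (t - k) / ((k : ℝ) * t) ≤ 1 / (k * t) :=
            div_le_div_of_nonneg_right (by linarith [ht.2]) (by positivity)
          have e2 : 1 / ((k : ℝ) * t) ≤ 1 / (k : ℝ) ^ 2 :=
            one_div_le_one_div_of_le (by positivity) (by rw [sq]; exact mul_le_mul_of_nonneg_left htk hk0.le)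
          exact e1.trans e2
        exact mul_le_mul (hB _) h1 (abs_nonneg _) hB0
      calc |(ψ (Real.log (d * k) / κ) - ψ (Real.log (d * t) / κ)) / t +
            ψ (Real.log (d * k) / κ) * (1 / k - 1 / t)|
          ≤ Λ * (1 / k) / k + B * (1 / k ^ 2) := (abs_add_le _ _).trans (add_le_add hA hB')
        _ = (Λ + B) * (1 / (k : ℝ) ^ 2) := by field_simp
    have := intervalIntegral.norm_integral_le_of_norm_le_const hbound
    rw [Real.norm_eq_abs, show |(k : ℝ) + 1 - k| = 1 by simp] at this
    linarith
  calc |∑ k ∈ Icc 1 n, h k - ∫ t in (1 : ℝ)..((n : ℝ) + 1), h t|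
      = |∑ k ∈ Icc 1 n, (h k - ∫ t in (k : ℝ)..((k : ℝ) + 1), h t)| := by
        rw [hsplit, ← sum_sub_distrib]
    _ ≤ ∑ k ∈ Icc 1 n, |h k - ∫ t in (k : ℝ)..((k : ℝ) + 1), h t| := abs_sum_le_sum_abs _ _
    _ ≤ ∑ k ∈ Icc 1 n, (Λ + B) * (1 / (k : ℝ) ^ 2) := sum_le_sum hterm
    _ = (Λ + B) * ∑ k ∈ Icc 1 n, 1 / (k : ℝ) ^ 2 := by rw [mul_sum]
    _ ≤ (Λ + B) * 2 := mul_le_mul_of_nonneg_left (sum_Icc_inv_sq_le_two n) (by positivity)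
    _ = 2 * (Λ + B) := by ring

/-- **The substitution `x = log(dt)/κ`**: `∫_a^b ψ(log(dt)/κ) dt/t = κ ∫_{log(da)/κ}^{log(db)/κ} ψ`
(`0 < a ≤ b`, `d > 0`, `κ ≠ 0`). [cite: BondarenkoHeap2026, §4 p. 12 ("after some basic substitutions")] -/
theorem integral_log_substitution {ψ : ℝ → ℝ} (hψc : Continuous ψ) {κ : ℝ} (hκ : κ ≠ 0)
    {d a b : ℝ} (hd : 0 < d) (ha : 0 < a) (hab : a ≤ b) :
    ∫ t in a..b, ψ (Real.log (d * t) / κ) / t =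
      κ * ∫ x in (Real.log (d * a) / κ)..(Real.log (d * b) / κ), ψ x := by
  have hderiv : ∀ t ∈ Set.uIcc a b, HasDerivAt (fun t => Real.log (d * t) / κ) (t⁻¹ / κ) t := by
    intro t ht
    rw [Set.uIcc_of_le hab] at ht
    have ht0 : t ≠ 0 := by linarith [ht.1]
    have h1 : HasDerivAt (fun t => d * t) d t := by
      simpa using (hasDerivAt_id t).const_mul d
    have h2 : HasDerivAt (fun t => Real.log (d * t)) (d / (d * t)) t :=
      h1.log (mul_ne_zero hd.ne' ht0)
    have h3 := h2.div_const κ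
    have e : d / (d * t) / κ = t⁻¹ / κ := by field_simp
    rw [e] at h3
    exact h3
  have hcont : ContinuousOn (fun t => t⁻¹ / κ) (Set.uIcc a b) := by
    refine ContinuousOn.div_const (continuousOn_inv₀.mono ?_) κ
    intro t ht
    rw [Set.uIcc_of_le hab] at ht
    simp only [Set.mem_compl_iff, Set.mem_singleton_iff]
    linarith [ht.1]
  have key := intervalIntegral.integral_comp_mul_deriv' hderiv hcont hψc.continuousOn
  -- `ψ(f t)/t = κ · (ψ (f t) · (t⁻¹/κ))`
  have hfun : (fun t => ψ (Real.log (d * t) / κ) / t) =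
      fun t => κ * (((ψ ∘ fun t => Real.log (d * t) / κ) t) * (t⁻¹ / κ)) := by
    funext t
    simp only [Function.comp_apply]
    field_simp
  rw [hfun, intervalIntegral.integral_const_mul, key]

/-- The clamp to `[0, 2]`. [folklore] -/
private def cl2 (t : ℝ) : ℝ := max 0 (min t 2)

/-- The clamp lands in `[0, 2]`. [folklore] -/
private theorem cl2_mem (t : ℝ) : cl2 t ∈ Set.Icc (0 : ℝ) 2 := by
  unfold cl2; exact ⟨le_max_left _ _, max_le (by norm_num) (min_le_right _ _)⟩

/-- The clamp is the identity on `[0, 2]`. [folklore] -/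
private theorem cl2_of_mem {t : ℝ} (ht : t ∈ Set.Icc (0 : ℝ) 2) : cl2 t = t := by
  unfold cl2; rw [min_eq_left ht.2, max_eq_right ht.1]

/-- The clamp is `1`-Lipschitz. [folklore] -/
private theorem abs_cl2_sub_le (t t' : ℝ) : |cl2 t - cl2 t'| ≤ |t - t'| := by
  unfold cl2
  calc |max 0 (min t 2) - max 0 (min t' 2)| ≤ max |(0:ℝ) - 0| |min t 2 - min t' 2| :=
        abs_max_sub_max_le_max _ _ _ _
    _ ≤ max |(0:ℝ) - 0| (max |t - t'| |(2:ℝ) - 2|) := by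
        gcongr; exact abs_min_sub_min_le_max _ _ _ _
    _ = |t - t'| := by simp [abs_nonneg]

/-- The clamp is continuous. [folklore] -/
private theorem continuous_cl2 : Continuous cl2 := by
  unfold cl2; exact continuous_const.max (continuous_id.min continuous_const)

/-- The clamped profile `ψ_u(x) = G₀(cl x) G₀(cl(x + u))` (`= G₀(x)G₀(x+u)`, the integrand of `C_G(u)`,
whenever `x, x + u ∈ [0, 2]`). [cite: BondarenkoHeap2026, Theorem 4 p. 8 (C_G)] -/
private def psiU (G₀ : Polynomial ℝ) (u x : ℝ) : ℝ := G₀.eval (cl2 x) * G₀.eval (cl2 (x + u))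

/-- `ψ_u` is continuous. [folklore] -/
private theorem continuous_psiU (G₀ : Polynomial ℝ) (u : ℝ) : Continuous (psiU G₀ u) := by
  unfold psiU
  exact (G₀.continuous.comp continuous_cl2).mul
    (G₀.continuous.comp (continuous_cl2.comp (continuous_id.add continuous_const)))

/-- `ψ_u(x) = G₀(x)G₀(x+u)` when `x, x + u ∈ [0, 2]`. [folklore] -/
private theorem psiU_eq (G₀ : Polynomial ℝ) {u x : ℝ} (hx : x ∈ Set.Icc (0 : ℝ) 2)
    (hxu : x + u ∈ Set.Icc (0 : ℝ) 2) : psiU G₀ u x = G₀.eval x * G₀.eval (x + u) := by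
  unfold psiU; rw [cl2_of_mem hx, cl2_of_mem hxu]

/-- Bounds for `|G₀|` and a Lipschitz constant for `G₀` on `[0, 2]`. [folklore] -/
private theorem exists_bound_lip_poly (G₀ : Polynomial ℝ) :
    ∃ M : ℝ, 0 ≤ M ∧ (∀ x ∈ Set.Icc (0 : ℝ) 2, |G₀.eval x| ≤ M) ∧
      ∀ a ∈ Set.Icc (0 : ℝ) 2, ∀ b ∈ Set.Icc (0 : ℝ) 2, |G₀.eval a - G₀.eval b| ≤ M * |a - b| := by
  obtain ⟨M₁, hM₁⟩ := isCompact_Icc.exists_bound_of_continuousOn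
    (G₀.continuous.continuousOn (s := Set.Icc (0:ℝ) 2))
  obtain ⟨M₂, hM₂⟩ := isCompact_Icc.exists_bound_of_continuousOn
    ((Polynomial.derivative G₀).continuous.continuousOn (s := Set.Icc (0:ℝ) 2))
  set M := max (max M₁ M₂) 0 with hM
  have hG : ∀ x ∈ Set.Icc (0 : ℝ) 2, |G₀.eval x| ≤ M := fun x hx => by
    have := hM₁ x hx; rw [Real.norm_eq_abs] at this
    exact this.trans ((le_max_left _ _).trans (le_max_left _ _))
  have hG' : ∀ x ∈ Set.Icc (0 : ℝ) 2, |(Polynomial.derivative G₀).eval x| ≤ M := fun x hx => by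
    have := hM₂ x hx; rw [Real.norm_eq_abs] at this
    exact this.trans ((le_max_right _ _).trans (le_max_left _ _))
  refine ⟨M, le_max_right _ _, hG, fun a ha b hb => ?_⟩
  have := Convex.norm_image_sub_le_of_norm_deriv_le (f := fun x => G₀.eval x) (s := Set.Icc (0:ℝ) 2)
    (fun x _ => G₀.differentiableAt) (fun x hx => by
      rw [Polynomial.deriv, Real.norm_eq_abs]; exact hG' x hx) (convex_Icc 0 2) hb ha
  simpa [Real.norm_eq_abs] using this

/-- `ψ_u` is bounded by `M²` and `2M²`-Lipschitz on `ℝ`. [folklore] -/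
private theorem psiU_bound_lip (G₀ : Polynomial ℝ) {M : ℝ} (hM0 : 0 ≤ M)
    (hG : ∀ x ∈ Set.Icc (0 : ℝ) 2, |G₀.eval x| ≤ M)
    (hL : ∀ a ∈ Set.Icc (0 : ℝ) 2, ∀ b ∈ Set.Icc (0 : ℝ) 2, |G₀.eval a - G₀.eval b| ≤ M * |a - b|)
    (u : ℝ) :
    (∀ x, |psiU G₀ u x| ≤ M ^ 2) ∧ ∀ x y, |psiU G₀ u x - psiU G₀ u y| ≤ 2 * M ^ 2 * |x - y| := by
  refine ⟨fun x => ?_, fun x y => ?_⟩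
  · unfold psiU
    rw [abs_mul, sq]
    exact mul_le_mul (hG _ (cl2_mem _)) (hG _ (cl2_mem _)) (abs_nonneg _) hM0
  · unfold psiU
    have e : G₀.eval (cl2 x) * G₀.eval (cl2 (x + u)) - G₀.eval (cl2 y) * G₀.eval (cl2 (y + u)) =
        (G₀.eval (cl2 x) - G₀.eval (cl2 y)) * G₀.eval (cl2 (x + u)) +
          G₀.eval (cl2 y) * (G₀.eval (cl2 (x + u)) - G₀.eval (cl2 (y + u))) := by ring
    rw [e]
    have h1 : |(G₀.eval (cl2 x) - G₀.eval (cl2 y)) * G₀.eval (cl2 (x + u))| ≤ M * |x - y| * M := by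
      rw [abs_mul]
      refine mul_le_mul ?_ (hG _ (cl2_mem _)) (abs_nonneg _) (by positivity)
      exact (hL _ (cl2_mem _) _ (cl2_mem _)).trans
        (mul_le_mul_of_nonneg_left (abs_cl2_sub_le _ _) hM0)
    have h2 : |G₀.eval (cl2 y) * (G₀.eval (cl2 (x + u)) - G₀.eval (cl2 (y + u)))| ≤
        M * (M * |x - y|) := by
      rw [abs_mul]
      refine mul_le_mul (hG _ (cl2_mem _)) ?_ (abs_nonneg _) hM0
      refine (hL _ (cl2_mem _) _ (cl2_mem _)).trans (mul_le_mul_of_nonneg_left ?_ hM0)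
      have := abs_cl2_sub_le (x + u) (y + u)
      rwa [show x + u - (y + u) = x - y by ring] at this
    calc _ ≤ M * |x - y| * M + M * (M * |x - y|) := (abs_add_le _ _).trans (add_le_add h1 h2)
      _ = 2 * M ^ 2 * |x - y| := by ring

/-- **The inner sum against its integral** (§4 p. 12, "by Euler–Maclaurin summation, the inner sum is
`∫_1^{L/d} … dx/x + O(1)` which, after some basic substitutions and estimates, is `… log L + O(log d)`"):
for `ψ` bounded by `B` and `Λ`-Lipschitz, `κ ≥ 1`, `y ≥ 1`, `d ≥ 1`,
`|Σ_{k ⩽ ⌊y⌋/d} ψ(log(dk)/κ)/k − κ ∫_0^{log y/κ} ψ| ≤ B log d + (2Λ + 3B)`.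
[cite: BondarenkoHeap2026, §4 p. 12 (Euler–Maclaurin step, O(log d))] -/
theorem inner_sum_estimate {ψ : ℝ → ℝ} {B Λ : ℝ} (hB0 : 0 ≤ B) (hΛ0 : 0 ≤ Λ)
    (hB : ∀ x, |ψ x| ≤ B) (hΛ : ∀ x y, |ψ x - ψ y| ≤ Λ * |x - y|) (hψc : Continuous ψ)
    {κ : ℝ} (hκ : 1 ≤ κ) {y : ℝ} (hy : 1 ≤ y) {d : ℕ} (hd : 1 ≤ d) :
    |∑ k ∈ Icc 1 (⌊y⌋₊ / d), ψ (Real.log (d * k) / κ) / k -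
        κ * ∫ x in (0 : ℝ)..(Real.log y / κ), ψ x| ≤ B * Real.log d + (2 * Λ + 3 * B) := by
  have hκ0 : 0 < κ := by linarith
  have hy0 : 0 < y := by linarith
  have hd1 : (1 : ℝ) ≤ d := by exact_mod_cast hd
  have hd0 : (0 : ℝ) < d := by linarith
  have hlogd : 0 ≤ Real.log d := Real.log_nonneg hd1
  have hlogy : 0 ≤ Real.log y := Real.log_nonneg hy
  have hint : ∀ a b : ℝ, IntervalIntegrable ψ MeasureTheory.volume a b :=
    fun a b => hψc.intervalIntegrable _ _
  -- bound for `κ ∫_a^b ψ`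
  have hIb : ∀ a b : ℝ, |κ * ∫ x in a..b, ψ x| ≤ κ * (B * |b - a|) := by
    intro a b
    rw [abs_mul, abs_of_pos hκ0]
    refine mul_le_mul_of_nonneg_left ?_ hκ0.le
    have := intervalIntegral.norm_integral_le_of_norm_le_const (a := a) (b := b) (f := ψ) (C := B)
      fun x _ => by rw [Real.norm_eq_abs]; exact hB x
    rwa [Real.norm_eq_abs] at this
  set z := ⌊y⌋₊ / d with hz
  rcases Nat.eq_zero_or_pos z with hz0 | hzpos
  · -- empty sum: `y < d`
    rw [hz0, show Icc 1 0 = (∅ : Finset ℕ) by rfl, sum_empty, zero_sub, abs_neg]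
    have hyd : y < d := by
      have : ⌊y⌋₊ < d := by
        rcases Nat.lt_or_ge ⌊y⌋₊ d with h | h
        · exact h
        · exfalso
          have : 1 ≤ ⌊y⌋₊ / d := (Nat.le_div_iff_mul_le (by omega)).mpr (by simpa using h)
          omega
      exact (Nat.floor_lt hy0.le).mp this
    calc |κ * ∫ x in (0 : ℝ)..(Real.log y / κ), ψ x| ≤ κ * (B * |Real.log y / κ - 0|) := hIb _ _
      _ = B * Real.log y := by
          rw [sub_zero, abs_of_nonneg (div_nonneg hlogy hκ0.le)]; field_simp
      _ ≤ B * Real.log d := by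
          refine mul_le_mul_of_nonneg_left (Real.log_le_log hy0 hyd.le) hB0
      _ ≤ B * Real.log d + (2 * Λ + 3 * B) := by linarith [mul_nonneg hB0 hlogd]
  · -- `z ≥ 1`: sum versus integral, substitution, and the two end corrections
    have hzy : (d : ℝ) * z ≤ y := by
      have h1 : d * z ≤ ⌊y⌋₊ := by rw [hz, mul_comm]; exact Nat.div_mul_le_self _ _
      calc (d : ℝ) * z = ((d * z : ℕ) : ℝ) := by push_cast; ring
        _ ≤ ⌊y⌋₊ := by exact_mod_cast h1
        _ ≤ y := Nat.floor_le hy0.le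
    have hdy : (d : ℝ) ≤ y := by
      have : (d : ℝ) * 1 ≤ d * z := mul_le_mul_of_nonneg_left (by exact_mod_cast hzpos) hd0.le
      linarith
    have hyz : y < (d : ℝ) * (z + 1) := by
      have h1 : ⌊y⌋₊ < d * (z + 1) := by
        have := Nat.lt_div_mul_add (a := ⌊y⌋₊) (b := d) (by omega)
        rw [hz]
        calc ⌊y⌋₊ < ⌊y⌋₊ / d * d + d := this
          _ = d * (⌊y⌋₊ / d + 1) := by ring
      have h2 : y < (⌊y⌋₊ : ℝ) + 1 := Nat.lt_floor_add_one y
      have h3 : (⌊y⌋₊ : ℝ) + 1 ≤ (d : ℝ) * (z + 1) := by exact_mod_cast h1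
      linarith
    have hS := sum_sub_integral_le hB0 hΛ0 hB hΛ hψc hκ hd1 z
    have hz1 : (1 : ℝ) ≤ (z : ℝ) + 1 := by
      have h0 : (0 : ℝ) ≤ z := Nat.cast_nonneg z
      linarith
    have hsub := integral_log_substitution hψc hκ0.ne' hd0 one_pos hz1
    rw [hsub, mul_one] at hS
    -- split the integral: `∫_{ld}^{lz} = (∫_0^{ly} + ∫_{ly}^{lz}) − ∫_0^{ld}`
    set ld := Real.log d / κ with hld
    set lz := Real.log ((d : ℝ) * ((z : ℝ) + 1)) / κ with hlz
    set ly := Real.log y / κ with hly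
    have hdecomp : κ * ∫ x in ld..lz, ψ x =
        κ * (∫ x in (0 : ℝ)..ly, ψ x) + κ * (∫ x in ly..lz, ψ x) - κ * ∫ x in (0 : ℝ)..ld, ψ x := by
      rw [← intervalIntegral.integral_interval_sub_left (hint 0 lz) (hint 0 ld),
        ← intervalIntegral.integral_add_adjacent_intervals (hint 0 ly) (hint ly lz)]
      ring
    have hE1 : |κ * ∫ x in ly..lz, ψ x| ≤ B := by
      refine (hIb _ _).trans ?_
      have hlzly : |lz - ly| ≤ 1 / κ := by
        rw [hlz, hly, ← sub_div, abs_div, abs_of_pos hκ0]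
        refine div_le_div_of_nonneg_right ?_ hκ0.le
        rw [← Real.log_div (by positivity) hy0.ne']
        have hge : 1 ≤ (d : ℝ) * (z + 1) / y := (one_le_div hy0).mpr hyz.le
        have hle : (d : ℝ) * (z + 1) / y ≤ 2 := by
          rw [div_le_iff₀ hy0]; nlinarith
        rw [abs_of_nonneg (Real.log_nonneg hge)]
        calc Real.log ((d : ℝ) * (z + 1) / y) ≤ Real.log 2 := Real.log_le_log (by positivity) hle
          _ ≤ 1 := by have := Real.log_two_lt_d9; linarith
      calc κ * (B * |lz - ly|) ≤ κ * (B * (1 / κ)) := by gcongr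
        _ = B := by field_simp
    have hE2 : |κ * ∫ x in (0 : ℝ)..ld, ψ x| ≤ B * Real.log d := by
      refine (hIb _ _).trans ?_
      rw [sub_zero, hld, abs_of_nonneg (div_nonneg hlogd hκ0.le)]
      apply le_of_eq; field_simp
    -- assemble
    have e : ∑ k ∈ Icc 1 z, ψ (Real.log (d * k) / κ) / k - κ * ∫ x in (0 : ℝ)..ly, ψ x =
        (∑ k ∈ Icc 1 z, ψ (Real.log (d * k) / κ) / k - κ * ∫ x in ld..lz, ψ x) +
          κ * (∫ x in ly..lz, ψ x) - κ * ∫ x in (0 : ℝ)..ld, ψ x := by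
      rw [hdecomp]; ring
    rw [e]
    calc |(∑ k ∈ Icc 1 z, ψ (Real.log (d * k) / κ) / k - κ * ∫ x in ld..lz, ψ x) +
          κ * (∫ x in ly..lz, ψ x) - κ * ∫ x in (0 : ℝ)..ld, ψ x|
        ≤ |∑ k ∈ Icc 1 z, ψ (Real.log (d * k) / κ) / k - κ * ∫ x in ld..lz, ψ x| +
            |κ * ∫ x in ly..lz, ψ x| + |κ * ∫ x in (0 : ℝ)..ld, ψ x| :=
          (abs_sub _ _).trans (add_le_add (abs_add_le _ _) le_rfl)
      _ ≤ 2 * (Λ + B) + B + B * Real.log d := add_le_add (add_le_add ?_ hE1) hE2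
      _ = B * Real.log d + (2 * Λ + 3 * B) := by ring
    exact hS

/-! ### (17) assembled -/

set_option maxHeartbeats 800000 in
/-- **(17)**, PROVED (§5 p. 13, "for the inner sum, arguing as before we find
`Σ_{m ⩽ L/p, (m,q)=1} G(m)G(pm)/m = C_G(log p/log L)(φ(q)/q) log L + O((log log q)²)`"), along the
§4 template (TeX l.566–580): `f(m) = 1` and `f(pm) = 1` off `L/2p < m ⩽ L/p` (an `O(1)`), Möbius over
`d ∣ q` (`sum_coprime_eq_sum_moebius`), the inner sums by `inner_sum_estimate` (Euler–Maclaurin in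
Lipschitz form + the substitution `x = log(dt)/log L`, error `O(1 + log d)`), `Σ_{d|q} μ(d)/d = φ(q)/q`,
and the total error `Σ_{d|q} μ²(d)(1 + log d)/d ≪ (log log q)²` (`sum_sqfree_divisors_log_le`).
Constants: `K = 4M² + 7M²·5e⁵` (`M` a bound and Lipschitz constant for `G₀` on `[0,2]`), `q₀ = 27`.
[cite: BondarenkoHeap2026, §5 (17) p. 13 and §4 p. 12] -/
theorem eq17_holds : eq17 := by
  intro ρ
  obtain ⟨M, hM0, hG, hLip⟩ := exists_bound_lip_poly ρ.G₀
  refine ⟨4 * M ^ 2 + 7 * M ^ 2 * (5 * Real.exp 5), 27, fun q hq p hp hpL => ?_⟩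
  have hM2 : 0 ≤ M ^ 2 := sq_nonneg _
  -- basic quantities
  have hqne : q ≠ 0 := by omega
  have hq0 : (0 : ℝ) < q := by exact_mod_cast (show 0 < q by omega)
  have hq1 : (1 : ℝ) < q := by exact_mod_cast (show 1 < q by omega)
  have hq27 : (27 : ℝ) ≤ q := by exact_mod_cast hq
  set ll := Real.log (Real.log q) with hll
  have hlogq3 : 3 < Real.log q := by
    have h27 : Real.log 27 = 3 * Real.log 3 := by
      rw [show (27 : ℝ) = 3 ^ 3 by norm_num, Real.log_pow]; norm_num
    have := MertensBound.one_lt_log_three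
    calc (3 : ℝ) < 3 * Real.log 3 := by linarith
      _ = Real.log 27 := h27.symm
      _ ≤ Real.log q := Real.log_le_log (by norm_num) hq27
  have hll1 : 1 ≤ ll := by
    rw [hll, Real.le_log_iff_exp_le (by linarith)]
    exact (Real.exp_one_lt_d9.le.trans (by norm_num)).trans hlogq3.le
  set L := lengthL q with hLdef
  have hLq : (q : ℝ) ≤ L := by
    have := Real.rpow_le_rpow_of_exponent_le hq1.le (show (1 : ℝ) ≤ 17 / 6 by norm_num)
    rw [Real.rpow_one] at this
    exact this
  have hL27 : 27 ≤ L := hq27.trans hLq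
  have hL0 : 0 < L := by linarith
  set κ := Real.log L with hκdef
  have hκ1 : 1 ≤ κ := by
    rw [hκdef, Real.le_log_iff_exp_le hL0]
    exact (Real.exp_one_lt_d9.le.trans (by norm_num)).trans hL27
  have hκ0 : 0 < κ := by linarith
  have hp2 : 2 ≤ p := hp.two_le
  have hp0 : (0 : ℝ) < p := by exact_mod_cast hp.pos
  have hp1 : (1 : ℝ) ≤ p := by exact_mod_cast hp.one_lt.le
  have hp2r : (2 : ℝ) ≤ p := by exact_mod_cast hp2
  set y := L / p with hydef
  have hy1 : 1 ≤ y := by rw [hydef, le_div_iff₀ hp0, one_mul]; exact hpL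
  have hy0 : 0 < y := by linarith
  have hpy : (p : ℝ) * y = L := by rw [hydef]; field_simp
  have hyL2 : 2 * y ≤ L := by
    calc 2 * y ≤ p * y := mul_le_mul_of_nonneg_right hp2r hy0.le
      _ = L := hpy
  set u := Real.log p / κ with hudef
  have hlogp0 : 0 ≤ Real.log p := Real.log_nonneg hp1
  have hu0 : 0 ≤ u := div_nonneg hlogp0 hκ0.le
  have hu1 : u ≤ 1 := by
    rw [hudef, div_le_one hκ0, hκdef]; exact Real.log_le_log hp0 hpL
  have hly : Real.log y / κ = 1 - u := by
    rw [hydef, Real.log_div hL0.ne' hp0.ne', ← hκdef, hudef, sub_div, div_self hκ0.ne']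
  set n := ⌊y⌋₊ with hndef
  have hnley : (n : ℝ) ≤ y := Nat.floor_le hy0.le
  -- the profile
  obtain ⟨hψB, hψL⟩ := psiU_bound_lip ρ.G₀ hM0 hG hLip u
  have hψc := continuous_psiU ρ.G₀ u
  have hΛ0 : (0 : ℝ) ≤ 2 * M ^ 2 := by positivity
  -- Step A: the summand
  have hterm : ∀ m ∈ (Icc 1 n).filter (fun m => Nat.Coprime m q),
      ρ.G q m * ρ.G q (p * m) / m =
        psiU ρ.G₀ u (Real.log m / κ) * ρ.f₀ ((p : ℝ) * m / L) / m := by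
    intro m hm
    have hm1 : 1 ≤ m := (mem_Icc.mp (mem_filter.mp hm).1).1
    have hmn : m ≤ n := (mem_Icc.mp (mem_filter.mp hm).1).2
    have hm0 : (0 : ℝ) < m := by exact_mod_cast hm1
    have hm1r : (1 : ℝ) ≤ m := by exact_mod_cast hm1
    have hmy : (m : ℝ) ≤ y := le_trans (by exact_mod_cast hmn) hnley
    have hmL : (m : ℝ) / L ∈ Set.Icc (0 : ℝ) (1 / 2) := by
      refine ⟨by positivity, ?_⟩
      rw [div_le_iff₀ hL0]; linarith
    have hf1 : ρ.f₀ ((m : ℝ) / L) = 1 := ρ.f₀_eq_one _ hmL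
    have hpmL : (p : ℝ) * m ≤ L := by
      calc (p : ℝ) * m ≤ p * y := mul_le_mul_of_nonneg_left hmy hp0.le
        _ = L := hpy
    have hpm1 : (1 : ℝ) ≤ (p : ℝ) * m := by nlinarith
    have hxm0 : 0 ≤ Real.log m / κ := div_nonneg (Real.log_nonneg hm1r) hκ0.le
    have hxm1 : Real.log m / κ ≤ 1 := by
      rw [div_le_one hκ0, hκdef]
      exact Real.log_le_log hm0 (hmy.trans (by linarith))
    have hxu : Real.log m / κ + u = Real.log ((p : ℝ) * m) / κ := by
      rw [Real.log_mul hp0.ne' hm0.ne', hudef]; ring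
    have hxu0 : 0 ≤ Real.log ((p : ℝ) * m) / κ := div_nonneg (Real.log_nonneg hpm1) hκ0.le
    have hxu1 : Real.log ((p : ℝ) * m) / κ ≤ 1 := by
      rw [div_le_one hκ0, hκdef]; exact Real.log_le_log (by positivity) hpmL
    rw [Resonator.G, Resonator.G, ← hLdef, ← hκdef, hf1, mul_one, Nat.cast_mul,
      psiU_eq ρ.G₀ ⟨hxm0, by linarith⟩ (by rw [hxu]; exact ⟨hxu0, by linarith⟩), hxu]
    ring
  -- Step A': replacing `f(pm)` by `1`
  have hΔ : |(∑ m ∈ (Icc 1 n).filter (fun m => Nat.Coprime m q),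
      psiU ρ.G₀ u (Real.log m / κ) * ρ.f₀ ((p : ℝ) * m / L) / m) -
      ∑ m ∈ (Icc 1 n).filter (fun m => Nat.Coprime m q), psiU ρ.G₀ u (Real.log m / κ) / m| ≤
      4 * M ^ 2 := by
    rw [← sum_sub_distrib]
    have hbd : ∀ m ∈ (Icc 1 n).filter (fun m => Nat.Coprime m q),
        |psiU ρ.G₀ u (Real.log m / κ) * ρ.f₀ ((p : ℝ) * m / L) / m -
          psiU ρ.G₀ u (Real.log m / κ) / m| ≤ 4 * M ^ 2 / y := by
      intro m hm
      have hm1 : 1 ≤ m := (mem_Icc.mp (mem_filter.mp hm).1).1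
      have hm0 : (0 : ℝ) < m := by exact_mod_cast hm1
      have e : psiU ρ.G₀ u (Real.log m / κ) * ρ.f₀ ((p : ℝ) * m / L) / m -
          psiU ρ.G₀ u (Real.log m / κ) / m =
          psiU ρ.G₀ u (Real.log m / κ) * (ρ.f₀ ((p : ℝ) * m / L) - 1) / m := by ring
      rw [e]
      by_cases hc : (p : ℝ) * m / L ≤ 1 / 2
      · rw [ρ.f₀_eq_one _ ⟨by positivity, hc⟩, sub_self, mul_zero, zero_div, abs_zero]
        positivity
      · have hmy2 : y < 2 * m := by
          rw [not_le, lt_div_iff₀ hL0] at hc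
          nlinarith [hpy, hp0]
        have hf : |ρ.f₀ ((p : ℝ) * m / L) - 1| ≤ 2 := by
          have := Glue.abs_f₀_le_one ρ (by positivity : (0 : ℝ) ≤ (p : ℝ) * m / L)
          calc |ρ.f₀ ((p : ℝ) * m / L) - 1| ≤ |ρ.f₀ ((p : ℝ) * m / L)| + |(1 : ℝ)| := abs_sub _ _
            _ ≤ 1 + 1 := by rw [abs_one]; linarith
            _ = 2 := by norm_num
        rw [abs_div, abs_mul, abs_of_pos hm0, div_le_div_iff₀ hm0 hy0]
        calc |psiU ρ.G₀ u (Real.log m / κ)| * |ρ.f₀ ((p : ℝ) * m / L) - 1| * y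
            ≤ M ^ 2 * 2 * y := by
              refine mul_le_mul_of_nonneg_right ?_ hy0.le
              exact mul_le_mul (hψB _) hf (abs_nonneg _) hM2
          _ ≤ 4 * M ^ 2 * m := by nlinarith
    calc _ ≤ ∑ m ∈ (Icc 1 n).filter (fun m => Nat.Coprime m q),
          |psiU ρ.G₀ u (Real.log m / κ) * ρ.f₀ ((p : ℝ) * m / L) / m -
            psiU ρ.G₀ u (Real.log m / κ) / m| := abs_sum_le_sum_abs _ _
      _ ≤ ∑ m ∈ (Icc 1 n).filter (fun m => Nat.Coprime m q), 4 * M ^ 2 / y := sum_le_sum hbd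
      _ ≤ ∑ m ∈ Icc 1 n, 4 * M ^ 2 / y :=
          sum_le_sum_of_subset_of_nonneg (filter_subset _ _) fun _ _ _ => by positivity
      _ = n * (4 * M ^ 2 / y) := by rw [sum_const, Nat.card_Icc]; simp
      _ ≤ y * (4 * M ^ 2 / y) := mul_le_mul_of_nonneg_right hnley (by positivity)
      _ = 4 * M ^ 2 := by field_simp
  -- Step B: Möbius
  have hMob := sum_coprime_eq_sum_moebius hqne (fun m => psiU ρ.G₀ u (Real.log m / κ) / m) n
  have hinner : ∀ d ∈ q.divisors,
      (μ d : ℝ) * ∑ k ∈ Icc 1 (n / d), psiU ρ.G₀ u (Real.log ((d * k : ℕ) : ℝ) / κ) / ((d * k : ℕ) : ℝ) =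
        (μ d : ℝ) / d * ∑ k ∈ Icc 1 (n / d), psiU ρ.G₀ u (Real.log ((d : ℝ) * k) / κ) / k := by
    intro d hd
    have hd0 : (d : ℝ) ≠ 0 := by exact_mod_cast (Nat.pos_of_mem_divisors hd).ne'
    rw [mul_sum, mul_sum]
    refine sum_congr rfl fun k hk => ?_
    have hk0 : (k : ℝ) ≠ 0 := by exact_mod_cast (show k ≠ 0 by have := (mem_Icc.mp hk).1; omega)
    push_cast
    field_simp
  rw [sum_congr rfl hinner] at hMob
  -- Step C: the inner sums
  have hmain : κ * ∫ x in (0 : ℝ)..(Real.log y / κ), psiU ρ.G₀ u x = κ * cG ρ.G₀ u := by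
    rw [hly, cG]
    congr 1
    refine intervalIntegral.integral_congr fun x hx => ?_
    rw [Set.uIcc_of_le (by linarith)] at hx
    exact psiU_eq ρ.G₀ ⟨hx.1, by linarith [hx.2]⟩ ⟨by linarith [hx.1], by linarith [hx.2]⟩
  have hE : ∀ d ∈ q.divisors,
      |(∑ k ∈ Icc 1 (n / d), psiU ρ.G₀ u (Real.log ((d : ℝ) * k) / κ) / k) - κ * cG ρ.G₀ u| ≤
        M ^ 2 * Real.log d + (2 * (2 * M ^ 2) + 3 * M ^ 2) := by
    intro d hd
    have hd1 : 1 ≤ d := Nat.pos_of_mem_divisors hd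
    have := inner_sum_estimate hM2 hΛ0 hψB hψL hψc hκ1 hy1 hd1
    rw [hmain] at this
    exact this
  -- Step D: `Σ_d μ(d)/d · I_d = (φ/q) κ C_G + R`
  have hsplit : ∑ d ∈ q.divisors, (μ d : ℝ) / d *
      ∑ k ∈ Icc 1 (n / d), psiU ρ.G₀ u (Real.log ((d : ℝ) * k) / κ) / k =
      (Nat.totient q : ℝ) / q * (κ * cG ρ.G₀ u) +
        ∑ d ∈ q.divisors, (μ d : ℝ) / d *
          ((∑ k ∈ Icc 1 (n / d), psiU ρ.G₀ u (Real.log ((d : ℝ) * k) / κ) / k) - κ * cG ρ.G₀ u) := by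
    rw [← Sieve.FouvryTenenbaum2021.sum_divisors_moebius_div_real (show 0 < q by omega), sum_mul, ← sum_add_distrib]
    refine sum_congr rfl fun d _ => ?_
    ring
  have hR : |∑ d ∈ q.divisors, (μ d : ℝ) / d *
      ((∑ k ∈ Icc 1 (n / d), psiU ρ.G₀ u (Real.log ((d : ℝ) * k) / κ) / k) - κ * cG ρ.G₀ u)| ≤
      7 * M ^ 2 * (5 * Real.exp 5 * ll ^ 2) := by
    calc _ ≤ ∑ d ∈ q.divisors, |(μ d : ℝ) / d *
          ((∑ k ∈ Icc 1 (n / d), psiU ρ.G₀ u (Real.log ((d : ℝ) * k) / κ) / k) - κ * cG ρ.G₀ u)| :=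
          abs_sum_le_sum_abs _ _
      _ ≤ ∑ d ∈ q.divisors, (if Squarefree d then 7 * M ^ 2 * ((1 + Real.log d) / d) else 0) := by
          refine sum_le_sum fun d hd => ?_
          have hd1 : 1 ≤ d := Nat.pos_of_mem_divisors hd
          have hd0 : (0 : ℝ) < d := by exact_mod_cast hd1
          have hlogd : 0 ≤ Real.log d := Real.log_nonneg (by exact_mod_cast hd1)
          rw [abs_mul, abs_div, abs_of_pos hd0]
          have hμ : |(μ d : ℝ)| = if Squarefree d then 1 else 0 := by
            rw [← Int.cast_abs, ArithmeticFunction.abs_moebius]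
            split_ifs <;> simp
          rw [hμ]
          split_ifs with hsq
          · calc 1 / (d : ℝ) * |(∑ k ∈ Icc 1 (n / d), psiU ρ.G₀ u (Real.log ((d : ℝ) * k) / κ) / k) -
                  κ * cG ρ.G₀ u| ≤ 1 / d * (M ^ 2 * Real.log d + (2 * (2 * M ^ 2) + 3 * M ^ 2)) :=
                  mul_le_mul_of_nonneg_left (hE d hd) (by positivity)
              _ ≤ 1 / d * (7 * M ^ 2 * (1 + Real.log d)) := by
                  refine mul_le_mul_of_nonneg_left ?_ (by positivity)
                  nlinarith
              _ = 7 * M ^ 2 * ((1 + Real.log d) / d) := by ring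
          · simp
      _ = 7 * M ^ 2 * ∑ d ∈ q.divisors with Squarefree d, (1 + Real.log d) / d := by
          rw [mul_sum, sum_filter]
      _ ≤ 7 * M ^ 2 * (5 * Real.exp 5 * ll ^ 2) :=
          mul_le_mul_of_nonneg_left (sum_sqfree_divisors_log_le hq) (by positivity)
  -- Step E: assembly
  rw [sum_congr rfl hterm]
  have hfin : (∑ m ∈ (Icc 1 n).filter (fun m => Nat.Coprime m q),
      psiU ρ.G₀ u (Real.log m / κ) * ρ.f₀ ((p : ℝ) * m / L) / m) -
      cG ρ.G₀ u * ((Nat.totient q : ℝ) / q) * κ =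
      ((∑ m ∈ (Icc 1 n).filter (fun m => Nat.Coprime m q),
        psiU ρ.G₀ u (Real.log m / κ) * ρ.f₀ ((p : ℝ) * m / L) / m) -
        ∑ m ∈ (Icc 1 n).filter (fun m => Nat.Coprime m q), psiU ρ.G₀ u (Real.log m / κ) / m) +
      ∑ d ∈ q.divisors, (μ d : ℝ) / d *
        ((∑ k ∈ Icc 1 (n / d), psiU ρ.G₀ u (Real.log ((d : ℝ) * k) / κ) / k) - κ * cG ρ.G₀ u) := by
    rw [hMob, hsplit]; ring
  rw [hfin]
  have hll2 : 1 ≤ ll ^ 2 := one_le_pow₀ hll1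
  have h4 : 4 * M ^ 2 ≤ 4 * M ^ 2 * ll ^ 2 := by
    have := mul_le_mul_of_nonneg_left hll2 (by positivity : (0 : ℝ) ≤ 4 * M ^ 2)
    linarith
  calc _ ≤ 4 * M ^ 2 + 7 * M ^ 2 * (5 * Real.exp 5 * ll ^ 2) :=
        (abs_add_le _ _).trans (add_le_add hΔ hR)
    _ ≤ 4 * M ^ 2 * ll ^ 2 + 7 * M ^ 2 * (5 * Real.exp 5 * ll ^ 2) := by linarith
    _ = (4 * M ^ 2 + 7 * M ^ 2 * (5 * Real.exp 5)) * ll ^ 2 := by ring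

set_option maxHeartbeats 800000 in
/-- **The diagonal of `I₀`** (§4 p. 12, proof of Theorem 3): "The diagonal is
`Ŵ_T(0) Σ_{n ⩽ L, (n,q)=1} G(n)²/n`. Inserting `1_{(n,q)=1} = Σ_{d|(n,q)} μ(d)` … the inner sum is
`∫_1^{L/d} G₀(log dx/log L)² dx/x + O(1)` which … is `D_G log L + O(log d)`. Then since
`Σ_{d|q} μ(d)/d = φ(q)/q` we acquire the main term … The total error is bounded by
`Σ_{d|q}(1 + log d)/d ≪ (log log q)²`": for every resonator datum there are `K, q₀` with
`|Σ_{n ⩽ L, (n,q)=1} G(n)²/n − D_G (φ(q)/q) log L| ≤ K (log log q)²` for `q ≥ q₀` (here `q₀ = 27`,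
`K = 2M² + 35e⁵M²`). PROVED with the machinery of (17) (`u = 0`).
[cite: BondarenkoHeap2026, §4 p. 12 (proof of Theorem 3, the diagonal; TeX l.561–580)] -/
theorem diagonal_I0_estimate (ρ : Resonator) : ∃ K : ℝ, ∃ q₀ : ℕ, ∀ q : ℕ, q₀ ≤ q →
    |(∑ n ∈ (Icc 1 ⌊lengthL q⌋₊).filter (fun n => Nat.Coprime n q), ρ.G q n ^ 2 / n) -
      dG ρ.G₀ * ((Nat.totient q : ℝ) / q) * Real.log (lengthL q)| ≤
        K * Real.log (Real.log q) ^ 2 := by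
  obtain ⟨M, hM0, hG, hLip⟩ := exists_bound_lip_poly ρ.G₀
  refine ⟨2 * M ^ 2 + 7 * M ^ 2 * (5 * Real.exp 5), 27, fun q hq => ?_⟩
  have hM2 : 0 ≤ M ^ 2 := sq_nonneg _
  have hqne : q ≠ 0 := by omega
  have hq0 : (0 : ℝ) < q := by exact_mod_cast (show 0 < q by omega)
  have hq1 : (1 : ℝ) < q := by exact_mod_cast (show 1 < q by omega)
  have hq27 : (27 : ℝ) ≤ q := by exact_mod_cast hq
  set ll := Real.log (Real.log q) with hll
  have hlogq3 : 3 < Real.log q := by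
    have h27 : Real.log 27 = 3 * Real.log 3 := by
      rw [show (27 : ℝ) = 3 ^ 3 by norm_num, Real.log_pow]; norm_num
    have := MertensBound.one_lt_log_three
    calc (3 : ℝ) < 3 * Real.log 3 := by linarith
      _ = Real.log 27 := h27.symm
      _ ≤ Real.log q := Real.log_le_log (by norm_num) hq27
  have hll1 : 1 ≤ ll := by
    rw [hll, Real.le_log_iff_exp_le (by linarith)]
    exact (Real.exp_one_lt_d9.le.trans (by norm_num)).trans hlogq3.le
  set L := lengthL q with hLdef
  have hLq : (q : ℝ) ≤ L := by
    have := Real.rpow_le_rpow_of_exponent_le hq1.le (show (1 : ℝ) ≤ 17 / 6 by norm_num)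
    rw [Real.rpow_one] at this
    exact this
  have hL27 : 27 ≤ L := hq27.trans hLq
  have hL0 : 0 < L := by linarith
  have hL1 : 1 ≤ L := by linarith
  set κ := Real.log L with hκdef
  have hκ1 : 1 ≤ κ := by
    rw [hκdef, Real.le_log_iff_exp_le hL0]
    exact (Real.exp_one_lt_d9.le.trans (by norm_num)).trans hL27
  have hκ0 : 0 < κ := by linarith
  have hly : Real.log L / κ = 1 := by rw [hκdef, div_self]; rw [← hκdef]; exact hκ0.ne'
  set n := ⌊L⌋₊ with hndef
  have hnleL : (n : ℝ) ≤ L := Nat.floor_le hL0.le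
  -- the profile with `u = 0`
  obtain ⟨hψB, hψL⟩ := psiU_bound_lip ρ.G₀ hM0 hG hLip 0
  have hψc := continuous_psiU ρ.G₀ 0
  have hΛ0 : (0 : ℝ) ≤ 2 * M ^ 2 := by positivity
  -- Step A: the summand
  have hterm : ∀ m ∈ (Icc 1 n).filter (fun m => Nat.Coprime m q),
      ρ.G q m ^ 2 / m = psiU ρ.G₀ 0 (Real.log m / κ) * ρ.f₀ ((m : ℝ) / L) ^ 2 / m := by
    intro m hm
    have hm1 : 1 ≤ m := (mem_Icc.mp (mem_filter.mp hm).1).1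
    have hmn : m ≤ n := (mem_Icc.mp (mem_filter.mp hm).1).2
    have hm0 : (0 : ℝ) < m := by exact_mod_cast hm1
    have hm1r : (1 : ℝ) ≤ m := by exact_mod_cast hm1
    have hmL : (m : ℝ) ≤ L := le_trans (by exact_mod_cast hmn) hnleL
    have hxm0 : 0 ≤ Real.log m / κ := div_nonneg (Real.log_nonneg hm1r) hκ0.le
    have hxm1 : Real.log m / κ ≤ 1 := by
      rw [div_le_one hκ0, hκdef]; exact Real.log_le_log hm0 hmL
    rw [Resonator.G, ← hLdef, ← hκdef,
      psiU_eq ρ.G₀ ⟨hxm0, by linarith⟩ (by rw [add_zero]; exact ⟨hxm0, by linarith⟩), add_zero]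
    ring
  -- Step A': replacing `f(m)²` by `1`
  have hΔ : |(∑ m ∈ (Icc 1 n).filter (fun m => Nat.Coprime m q),
      psiU ρ.G₀ 0 (Real.log m / κ) * ρ.f₀ ((m : ℝ) / L) ^ 2 / m) -
      ∑ m ∈ (Icc 1 n).filter (fun m => Nat.Coprime m q), psiU ρ.G₀ 0 (Real.log m / κ) / m| ≤
      2 * M ^ 2 := by
    rw [← sum_sub_distrib]
    have hbd : ∀ m ∈ (Icc 1 n).filter (fun m => Nat.Coprime m q),
        |psiU ρ.G₀ 0 (Real.log m / κ) * ρ.f₀ ((m : ℝ) / L) ^ 2 / m -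
          psiU ρ.G₀ 0 (Real.log m / κ) / m| ≤ 2 * M ^ 2 / L := by
      intro m hm
      have hm1 : 1 ≤ m := (mem_Icc.mp (mem_filter.mp hm).1).1
      have hm0 : (0 : ℝ) < m := by exact_mod_cast hm1
      have e : psiU ρ.G₀ 0 (Real.log m / κ) * ρ.f₀ ((m : ℝ) / L) ^ 2 / m -
          psiU ρ.G₀ 0 (Real.log m / κ) / m =
          psiU ρ.G₀ 0 (Real.log m / κ) * (ρ.f₀ ((m : ℝ) / L) ^ 2 - 1) / m := by ring
      rw [e]
      by_cases hc : (m : ℝ) / L ≤ 1 / 2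
      · rw [ρ.f₀_eq_one _ ⟨by positivity, hc⟩, one_pow, sub_self, mul_zero, zero_div, abs_zero]
        positivity
      · have hmy2 : L < 2 * m := by
          rw [not_le, lt_div_iff₀ hL0] at hc
          linarith
        have hf : |ρ.f₀ ((m : ℝ) / L) ^ 2 - 1| ≤ 1 := by
          have h1 := Glue.abs_f₀_le_one ρ (by positivity : (0 : ℝ) ≤ (m : ℝ) / L)
          have h2 : ρ.f₀ ((m : ℝ) / L) ^ 2 ≤ 1 := by
            have := abs_le.mp h1
            nlinarith
          have h3 : 0 ≤ ρ.f₀ ((m : ℝ) / L) ^ 2 := sq_nonneg _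
          rw [abs_le]; constructor <;> linarith
        rw [abs_div, abs_mul, abs_of_pos hm0, div_le_div_iff₀ hm0 hL0]
        calc |psiU ρ.G₀ 0 (Real.log m / κ)| * |ρ.f₀ ((m : ℝ) / L) ^ 2 - 1| * L
            ≤ M ^ 2 * 1 * L := by
              refine mul_le_mul_of_nonneg_right ?_ hL0.le
              exact mul_le_mul (hψB _) hf (abs_nonneg _) hM2
          _ ≤ 2 * M ^ 2 * m := by nlinarith
    calc _ ≤ ∑ m ∈ (Icc 1 n).filter (fun m => Nat.Coprime m q),
          |psiU ρ.G₀ 0 (Real.log m / κ) * ρ.f₀ ((m : ℝ) / L) ^ 2 / m -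
            psiU ρ.G₀ 0 (Real.log m / κ) / m| := abs_sum_le_sum_abs _ _
      _ ≤ ∑ m ∈ (Icc 1 n).filter (fun m => Nat.Coprime m q), 2 * M ^ 2 / L := sum_le_sum hbd
      _ ≤ ∑ m ∈ Icc 1 n, 2 * M ^ 2 / L :=
          sum_le_sum_of_subset_of_nonneg (filter_subset _ _) fun _ _ _ => by positivity
      _ = n * (2 * M ^ 2 / L) := by rw [sum_const, Nat.card_Icc]; simp
      _ ≤ L * (2 * M ^ 2 / L) := mul_le_mul_of_nonneg_right hnleL (by positivity)
      _ = 2 * M ^ 2 := by field_simp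
  -- Step B: Möbius
  have hMob := sum_coprime_eq_sum_moebius hqne (fun m => psiU ρ.G₀ 0 (Real.log m / κ) / m) n
  have hinner : ∀ d ∈ q.divisors,
      (μ d : ℝ) * ∑ k ∈ Icc 1 (n / d), psiU ρ.G₀ 0 (Real.log ((d * k : ℕ) : ℝ) / κ) / ((d * k : ℕ) : ℝ) =
        (μ d : ℝ) / d * ∑ k ∈ Icc 1 (n / d), psiU ρ.G₀ 0 (Real.log ((d : ℝ) * k) / κ) / k := by
    intro d hd
    have hd0 : (d : ℝ) ≠ 0 := by exact_mod_cast (Nat.pos_of_mem_divisors hd).ne'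
    rw [mul_sum, mul_sum]
    refine sum_congr rfl fun k hk => ?_
    have hk0 : (k : ℝ) ≠ 0 := by exact_mod_cast (show k ≠ 0 by have := (mem_Icc.mp hk).1; omega)
    push_cast
    field_simp
  rw [sum_congr rfl hinner] at hMob
  -- Step C: the inner sums; main term `κ D_G`
  have hmain : κ * ∫ x in (0 : ℝ)..(Real.log L / κ), psiU ρ.G₀ 0 x = κ * dG ρ.G₀ := by
    rw [hly, dG]
    congr 1
    refine intervalIntegral.integral_congr fun x hx => ?_
    rw [Set.uIcc_of_le (by norm_num)] at hx
    rw [psiU_eq ρ.G₀ ⟨hx.1, by linarith [hx.2]⟩ (by rw [add_zero]; exact ⟨hx.1, by linarith [hx.2]⟩),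
      add_zero, sq]
  have hE : ∀ d ∈ q.divisors,
      |(∑ k ∈ Icc 1 (n / d), psiU ρ.G₀ 0 (Real.log ((d : ℝ) * k) / κ) / k) - κ * dG ρ.G₀| ≤
        M ^ 2 * Real.log d + (2 * (2 * M ^ 2) + 3 * M ^ 2) := by
    intro d hd
    have hd1 : 1 ≤ d := Nat.pos_of_mem_divisors hd
    have := inner_sum_estimate hM2 hΛ0 hψB hψL hψc hκ1 hL1 hd1
    rw [hmain] at this
    exact this
  -- Step D
  have hsplit : ∑ d ∈ q.divisors, (μ d : ℝ) / d *
      ∑ k ∈ Icc 1 (n / d), psiU ρ.G₀ 0 (Real.log ((d : ℝ) * k) / κ) / k =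
      (Nat.totient q : ℝ) / q * (κ * dG ρ.G₀) +
        ∑ d ∈ q.divisors, (μ d : ℝ) / d *
          ((∑ k ∈ Icc 1 (n / d), psiU ρ.G₀ 0 (Real.log ((d : ℝ) * k) / κ) / k) - κ * dG ρ.G₀) := by
    rw [← Sieve.FouvryTenenbaum2021.sum_divisors_moebius_div_real (show 0 < q by omega), sum_mul, ← sum_add_distrib]
    refine sum_congr rfl fun d _ => ?_
    ring
  have hR : |∑ d ∈ q.divisors, (μ d : ℝ) / d *
      ((∑ k ∈ Icc 1 (n / d), psiU ρ.G₀ 0 (Real.log ((d : ℝ) * k) / κ) / k) - κ * dG ρ.G₀)| ≤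
      7 * M ^ 2 * (5 * Real.exp 5 * ll ^ 2) := by
    calc _ ≤ ∑ d ∈ q.divisors, |(μ d : ℝ) / d *
          ((∑ k ∈ Icc 1 (n / d), psiU ρ.G₀ 0 (Real.log ((d : ℝ) * k) / κ) / k) - κ * dG ρ.G₀)| :=
          abs_sum_le_sum_abs _ _
      _ ≤ ∑ d ∈ q.divisors, (if Squarefree d then 7 * M ^ 2 * ((1 + Real.log d) / d) else 0) := by
          refine sum_le_sum fun d hd => ?_
          have hd1 : 1 ≤ d := Nat.pos_of_mem_divisors hd
          have hd0 : (0 : ℝ) < d := by exact_mod_cast hd1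
          have hlogd : 0 ≤ Real.log d := Real.log_nonneg (by exact_mod_cast hd1)
          rw [abs_mul, abs_div, abs_of_pos hd0]
          have hμ : |(μ d : ℝ)| = if Squarefree d then 1 else 0 := by
            rw [← Int.cast_abs, ArithmeticFunction.abs_moebius]
            split_ifs <;> simp
          rw [hμ]
          split_ifs with hsq
          · calc 1 / (d : ℝ) * |(∑ k ∈ Icc 1 (n / d), psiU ρ.G₀ 0 (Real.log ((d : ℝ) * k) / κ) / k) -
                  κ * dG ρ.G₀| ≤ 1 / d * (M ^ 2 * Real.log d + (2 * (2 * M ^ 2) + 3 * M ^ 2)) :=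
                  mul_le_mul_of_nonneg_left (hE d hd) (by positivity)
              _ ≤ 1 / d * (7 * M ^ 2 * (1 + Real.log d)) := by
                  refine mul_le_mul_of_nonneg_left ?_ (by positivity)
                  nlinarith
              _ = 7 * M ^ 2 * ((1 + Real.log d) / d) := by ring
          · simp
      _ = 7 * M ^ 2 * ∑ d ∈ q.divisors with Squarefree d, (1 + Real.log d) / d := by
          rw [mul_sum, sum_filter]
      _ ≤ 7 * M ^ 2 * (5 * Real.exp 5 * ll ^ 2) :=
          mul_le_mul_of_nonneg_left (sum_sqfree_divisors_log_le hq) (by positivity)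
  -- Step E
  rw [sum_congr rfl hterm]
  have hfin : (∑ m ∈ (Icc 1 n).filter (fun m => Nat.Coprime m q),
      psiU ρ.G₀ 0 (Real.log m / κ) * ρ.f₀ ((m : ℝ) / L) ^ 2 / m) -
      dG ρ.G₀ * ((Nat.totient q : ℝ) / q) * κ =
      ((∑ m ∈ (Icc 1 n).filter (fun m => Nat.Coprime m q),
        psiU ρ.G₀ 0 (Real.log m / κ) * ρ.f₀ ((m : ℝ) / L) ^ 2 / m) -
        ∑ m ∈ (Icc 1 n).filter (fun m => Nat.Coprime m q), psiU ρ.G₀ 0 (Real.log m / κ) / m) +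
      ∑ d ∈ q.divisors, (μ d : ℝ) / d *
        ((∑ k ∈ Icc 1 (n / d), psiU ρ.G₀ 0 (Real.log ((d : ℝ) * k) / κ) / k) - κ * dG ρ.G₀) := by
    rw [hMob, hsplit]; ring
  rw [hfin]
  have hll2 : 1 ≤ ll ^ 2 := one_le_pow₀ hll1
  have h4 : 2 * M ^ 2 ≤ 2 * M ^ 2 * ll ^ 2 := by
    have := mul_le_mul_of_nonneg_left hll2 (by positivity : (0 : ℝ) ≤ 2 * M ^ 2)
    linarith
  calc _ ≤ 2 * M ^ 2 + 7 * M ^ 2 * (5 * Real.exp 5 * ll ^ 2) :=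
        (abs_add_le _ _).trans (add_le_add hΔ hR)
    _ ≤ 2 * M ^ 2 * ll ^ 2 + 7 * M ^ 2 * (5 * Real.exp 5 * ll ^ 2) := by linarith
    _ = (2 * M ^ 2 + 7 * M ^ 2 * (5 * Real.exp 5)) * ll ^ 2 := by ring

/-- **Proposition 5 ⇐ Proposition 3** (with (17) = `eq17_holds`, (18) = `eq18_holds`, (3) =
`cPhi_pos_holds`/`weightHat_zero_holds`): BH26:Prop5 is a theorem MODULO Heath-Brown's Lemma 3
(`prop3`) alone. [cite: BondarenkoHeap2026, Proposition 5 (proof, §5 pp. 13–14)] -/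
theorem prop5_of_prop3 (h3 : prop3) : prop5 :=
  prop5_of_eq17_prop3 eq17_holds h3

/-- **Theorem 4 ⇐ Proposition 3 + Proposition 6.** [cite: BondarenkoHeap2026, Theorem 4 (proof: Propositions 5 and 6)] -/
theorem theorem4_of_prop3_prop6 (h3 : prop3) (h6 : prop6) : theorem4 :=
  theorem4_of_eq17_prop3_prop6 eq17_holds h3 h6

end Eq17Proof

/-! ### §4 (15): `I₀` opened as a double sum -/

section Eq15Proof

open MeasureTheory
open scoped ComplexConjugate

/-- `∫ cos(tθ) W_T(t) dt = Ŵ_T(θ/2π)` (`T > 0`; the Fourier transform of the real even weight).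
[cite: BondarenkoHeap2026, §4 (15) p. 11] -/
theorem integral_cos_mul_weight (w : Bump) (B : ℕ) {T : ℝ} (hT : 0 < T) (θ : ℝ) :
    ∫ t, Real.cos (t * θ) * weight w B T t = weightHat w B T (θ / (2 * π)) := by
  rw [weightHat, Real.fourier_real_eq_integral_exp_smul]
  have hW := Extension.integrable_weight w B hT
  have hWc : Integrable (fun v : ℝ => ((weight w B T v : ℝ) : ℂ)) := hW.ofReal
  have hint : Integrable (fun v : ℝ =>
      Complex.exp (↑(-2 * π * v * (θ / (2 * π))) * Complex.I) • ((weight w B T v : ℝ) : ℂ)) := by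
    refine (hWc.bdd_mul (c := 1) ?_ ?_)
    · exact (Complex.continuous_exp.comp ((Complex.continuous_ofReal.comp (by fun_prop)).mul
        continuous_const)).aestronglyMeasurable
    · exact Filter.Eventually.of_forall fun v => (Complex.norm_exp_ofReal_mul_I _).le
  have hre := integral_re hint
  simp only [RCLike.re_to_complex] at hre
  rw [← hre]
  congr 1
  funext v
  simp only [smul_eq_mul]
  have e : (((-2 * π * v * (θ / (2 * π))) : ℝ) : ℂ) * Complex.I = (((-(v * θ)) : ℝ) : ℂ) * Complex.I := by
    congr 1
    push_cast
    field_simp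
  rw [e, Complex.exp_mul_I, ← Complex.ofReal_cos, ← Complex.ofReal_sin]
  simp only [Complex.mul_re, Complex.add_re, Complex.add_im, Complex.ofReal_re, Complex.ofReal_im,
    Complex.mul_im, Complex.I_re, Complex.I_im, Real.cos_neg]
  ring

/-- The summand of `R(t)`: `r(n) n^{−1/2−it} = r(n) n^{−1/2} · e^{−it log n}` (`n ≥ 1`). [folklore] -/
private theorem term_eq (r : ℕ → ℝ) (t : ℝ) {n : ℕ} (hn : 1 ≤ n) :
    (r n : ℂ) * (n : ℂ) ^ (-(1 / 2 : ℂ) - t * Complex.I) =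
      ((r n * (n : ℝ) ^ (-(1 / 2 : ℝ)) : ℝ) : ℂ) * Complex.exp ((((-(t * Real.log n)) : ℝ) : ℂ) * Complex.I) := by
  have hn0 : (n : ℂ) ≠ 0 := by exact_mod_cast (show n ≠ 0 by omega)
  have hnpos : (0 : ℝ) < n := by exact_mod_cast hn
  rw [Complex.cpow_def_of_ne_zero hn0, ← Complex.natCast_log, Real.rpow_def_of_pos hnpos]
  push_cast
  rw [mul_assoc, ← Complex.exp_add]
  congr 1
  ring

/-- **`|R(t)|²` as a double sum**: `|Σ_n r(n) n^{−1/2−it}|² = Σ_{m,n} r(m)r(n)/√(mn) · cos(t log(n/m))`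
(real coefficients). [cite: BondarenkoHeap2026, §4 (15) p. 11] -/
theorem norm_dirichletPoly_sq (r : ℕ → ℝ) (L t : ℝ) :
    ‖dirichletPoly r L t‖ ^ 2 = ∑ m ∈ Icc 1 ⌊L⌋₊, ∑ n ∈ Icc 1 ⌊L⌋₊,
      r m * r n / Real.sqrt ((m : ℝ) * n) * Real.cos (t * Real.log ((n : ℝ) / m)) := by
  set N := ⌊L⌋₊ with hN
  set a : ℕ → ℝ := fun n => r n * (n : ℝ) ^ (-(1 / 2 : ℝ)) with ha
  set e : ℕ → ℂ := fun n => Complex.exp ((((-(t * Real.log n)) : ℝ) : ℂ) * Complex.I) with he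
  have hR : dirichletPoly r L t = ∑ n ∈ Icc 1 N, (a n : ℂ) * e n := by
    rw [dirichletPoly]
    refine sum_congr rfl fun n hn => ?_
    exact term_eq r t (mem_Icc.mp hn).1
  -- `‖z‖² = re (z · conj z)`
  have hsq : ‖dirichletPoly r L t‖ ^ 2 = (dirichletPoly r L t * conj (dirichletPoly r L t)).re := by
    rw [Complex.mul_conj, Complex.ofReal_re, Complex.normSq_eq_norm_sq]
  rw [hsq, hR, map_sum, sum_mul_sum, Complex.re_sum]
  refine sum_congr rfl fun m hm => ?_
  rw [Complex.re_sum]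
  refine sum_congr rfl fun n hn => ?_
  have hm1 : 1 ≤ m := (mem_Icc.mp hm).1
  have hn1 : 1 ≤ n := (mem_Icc.mp hn).1
  have hm0 : (0 : ℝ) < m := by exact_mod_cast hm1
  have hn0 : (0 : ℝ) < n := by exact_mod_cast hn1
  -- conj (a n · e n) = a n · exp(+ i t log n)
  have hconj : conj ((a n : ℂ) * e n) = (a n : ℂ) * Complex.exp ((((t * Real.log n) : ℝ) : ℂ) * Complex.I) := by
    rw [map_mul, Complex.conj_ofReal, he]
    simp only
    rw [← Complex.exp_conj, map_mul, Complex.conj_ofReal, Complex.conj_I]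
    congr 1
    push_cast
    ring
  rw [hconj]
  -- product of the exponentials
  have hexp : e m * Complex.exp ((((t * Real.log n) : ℝ) : ℂ) * Complex.I) =
      Complex.exp ((((t * Real.log ((n : ℝ) / m)) : ℝ) : ℂ) * Complex.I) := by
    rw [he]
    simp only
    rw [← Complex.exp_add, Real.log_div hn0.ne' hm0.ne']
    congr 1
    push_cast
    ring
  have e1 : (a m : ℂ) * e m * ((a n : ℂ) * Complex.exp ((((t * Real.log n) : ℝ) : ℂ) * Complex.I)) =
      ((a m * a n : ℝ) : ℂ) * (e m * Complex.exp ((((t * Real.log n) : ℝ) : ℂ) * Complex.I)) := by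
    push_cast; ring
  rw [e1, hexp, Complex.exp_mul_I, ← Complex.ofReal_cos, ← Complex.ofReal_sin]
  simp only [Complex.mul_re, Complex.add_re, Complex.add_im, Complex.ofReal_re, Complex.ofReal_im,
    Complex.mul_im, Complex.I_re, Complex.I_im]
  -- `a m a n = r m r n / √(mn)`
  have hamn : a m * a n = r m * r n / Real.sqrt ((m : ℝ) * n) := by
    simp only [ha]
    rw [Real.sqrt_eq_rpow, Real.mul_rpow hm0.le hn0.le]
    rw [show (-(1 / 2 : ℝ)) = -(1 / 2) by rfl, Real.rpow_neg hm0.le, Real.rpow_neg hn0.le]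
    field_simp
  rw [hamn]
  ring

/-- **(15)**: "Opening the square and integrating, `I₀ = Σ_{m,n ⩽ L} χ(m)χ(n)G(m)G(n)/√(mn) ·
Ŵ_T(log(n/m)/2π)`" — for any real coefficients `r` and `T > 0`,
`I₀ = ∫ |R|² W_T = Σ_{m,n ⩽ L} r(m) r(n)/√(mn) Ŵ_T(log(n/m)/2π)`. PROVED (finite sum, `W_T ∈ L¹`
by the sibling `Extension.integrable_weight`, and `∫ cos(tθ) W_T = Ŵ_T(θ/2π)`).
[cite: BondarenkoHeap2026, §4 (15) p. 11] -/
theorem I0R_eq_sum (w : Bump) (B : ℕ) (r : ℕ → ℝ) (L : ℝ) {T : ℝ} (hT : 0 < T) :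
    I0R w B r L T = ∑ m ∈ Icc 1 ⌊L⌋₊, ∑ n ∈ Icc 1 ⌊L⌋₊,
      r m * r n / Real.sqrt ((m : ℝ) * n) * weightHat w B T (Real.log ((n : ℝ) / m) / (2 * π)) := by
  rw [I0R]
  simp_rw [norm_dirichletPoly_sq, sum_mul]
  have hW := Extension.integrable_weight w B hT
  have hint : ∀ m n : ℕ, Integrable (fun t : ℝ =>
      r m * r n / Real.sqrt ((m : ℝ) * n) * Real.cos (t * Real.log ((n : ℝ) / m)) * weight w B T t) := by
    intro m n
    have h1 : Integrable (fun t : ℝ => Real.cos (t * Real.log ((n : ℝ) / m)) * weight w B T t) := by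
      refine hW.bdd_mul (c := 1) (by fun_prop) ?_
      exact Filter.Eventually.of_forall fun t => by
        rw [Real.norm_eq_abs]; exact Real.abs_cos_le_one _
    have := h1.const_mul (r m * r n / Real.sqrt ((m : ℝ) * n))
    refine this.congr (Filter.Eventually.of_forall fun t => ?_)
    simp only; ring
  rw [integral_finsetSum _ fun m _ => integrable_finsetSum _ fun n _ => hint m n]
  refine sum_congr rfl fun m _ => ?_
  rw [integral_finsetSum _ fun n _ => hint m n]
  refine sum_congr rfl fun n _ => ?_
  rw [← integral_cos_mul_weight w B hT]
  rw [← integral_const_mul]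
  refine integral_congr_ae (Filter.Eventually.of_forall fun t => ?_)
  simp only; ring

/-- (15) for the resonator of §2.3: `I₀ = Σ_{m,n ⩽ L} χ(m)χ(n)G(m)G(n)/√(mn) Ŵ_T(log(n/m)/2π)` with
`L = q^{17/6}`, `T = q^{7/3+δ}` (`q ≥ 1`). [cite: BondarenkoHeap2026, §4 (15) p. 11] -/
theorem eq15 (w : Bump) (B : ℕ) (ρ : Resonator) {q : ℕ} (hq : 1 ≤ q) (χ : DirichletCharacter ℂ q) :
    I0R w B (ρ.coeff χ) (lengthL q) (ρ.T q) =
      ∑ m ∈ Icc 1 ⌊lengthL q⌋₊, ∑ n ∈ Icc 1 ⌊lengthL q⌋₊,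
        ρ.coeff χ m * ρ.coeff χ n / Real.sqrt ((m : ℝ) * n) *
          weightHat w B (ρ.T q) (Real.log ((n : ℝ) / m) / (2 * π)) := by
  have hT : 0 < ρ.T q := by
    have hq1 : (1 : ℝ) ≤ q := by exact_mod_cast hq
    exact lt_of_lt_of_le (by linarith) (le_T ρ hq)
  exact I0R_eq_sum w B (ρ.coeff χ) (lengthL q) hT

end Eq15Proof

/-! ### §4: Theorem 3 reduced to its off-diagonal estimate (glue) -/

section Theorem3Glue

/-- `(log log q)^n ≤ ε log q` for `q ≥ q₀(n, ε)`. [folklore] -/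
private theorem exists_loglog_pow_le (n : ℕ) {ε : ℝ} (hε : 0 < ε) :
    ∃ q₀ : ℕ, ∀ q : ℕ, q₀ ≤ q → Real.log (Real.log q) ^ n ≤ ε * Real.log q := by
  have h := (Real.isLittleO_pow_log_id_atTop (n := n)).bound hε
  have h2 := (Real.tendsto_log_atTop.comp tendsto_natCast_atTop_atTop).eventually h
  obtain ⟨q₀, hq₀⟩ := Filter.eventually_atTop.mp h2
  refine ⟨max q₀ 1, fun q hq => ?_⟩
  have hq1 : 1 ≤ q := le_trans (le_max_right _ _) hq
  have hb := hq₀ q (le_trans (le_max_left _ _) hq)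
  simp only [Function.comp_apply, id_eq, Real.norm_eq_abs] at hb
  have hlog0 : 0 ≤ Real.log q := Real.log_nonneg (by exact_mod_cast hq1)
  rw [abs_of_nonneg hlog0] at hb
  exact (le_abs_self _).trans hb

/-- **The off-diagonal part of (15)**: `Σ_{m ≠ n ⩽ L} r(m)r(n)/√(mn) Ŵ_T(log(n/m)/2π)` for the
resonator coefficients `r = χG` (§4 p. 12: "For the off-diagonals, put `n = m + r` …").
[cite: BondarenkoHeap2026, §4 p. 12 (proof of Theorem 3, off-diagonal terms)] -/
def offDiagI0 (w : Bump) (B : ℕ) (ρ : Resonator) {q : ℕ} (χ : DirichletCharacter ℂ q) : ℝ :=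
  ∑ m ∈ Icc 1 ⌊lengthL q⌋₊, ∑ n ∈ Icc 1 ⌊lengthL q⌋₊,
    if m = n then 0 else
      ρ.coeff χ m * ρ.coeff χ n / Real.sqrt ((m : ℝ) * n) *
        weightHat w B (ρ.T q) (Real.log ((n : ℝ) / m) / (2 * π))

/-- `χ(m)² = 1_{(m,q)=1}` for a quadratic character (private copy). [folklore] -/
private theorem re_sq_quadratic' {q : ℕ} {χ : DirichletCharacter ℂ q} (hχ : χ.IsQuadratic) (m : ℕ) :
    (χ (m : ZMod q)).re ^ 2 = if m.Coprime q then 1 else 0 := by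
  by_cases hm : m.Coprime q
  · have hu : IsUnit ((m : ℕ) : ZMod q) := (ZMod.isUnit_iff_coprime m q).mpr hm
    rw [if_pos hm]
    rcases hχ (m : ZMod q) with h | h | h
    · exact absurd h (hu.map χ).ne_zero
    · simp [h]
    · simp [h]
  · rw [if_neg hm, χ.map_nonunit (mt (ZMod.isUnit_iff_coprime m q).mp hm)]
    simp

/-- `r(m)² = 1_{(m,q)=1} G(m)²` for `r = χG`, `χ` quadratic. [cite: BondarenkoHeap2026, §4 p. 12 ("The diagonal is Ŵ_T(0) Σ_{(n,q)=1} G(n)²/n")] -/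
theorem coeff_sq {q : ℕ} {χ : DirichletCharacter ℂ q} (hχ : χ.IsQuadratic) (ρ : Resonator) (m : ℕ) :
    ρ.coeff χ m ^ 2 = if m.Coprime q then ρ.G q m ^ 2 else 0 := by
  rw [Resonator.coeff, mul_pow, re_sq_quadratic' hχ]
  split_ifs <;> simp

/-- **Diagonal/off-diagonal split of (15)**: `Σ_{m,n} = Ŵ_T(0) Σ_{n ⩽ L, (n,q)=1} G(n)²/n + offDiagI0`.
[cite: BondarenkoHeap2026, §4 p. 12 (proof of Theorem 3: "The diagonal is …")] -/
theorem doubleSum_eq_diag_add_offDiag (w : Bump) (B : ℕ) (ρ : Resonator) {q : ℕ}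
    {χ : DirichletCharacter ℂ q} (hχ : χ.IsQuadratic) :
    ∑ m ∈ Icc 1 ⌊lengthL q⌋₊, ∑ n ∈ Icc 1 ⌊lengthL q⌋₊,
        ρ.coeff χ m * ρ.coeff χ n / Real.sqrt ((m : ℝ) * n) *
          weightHat w B (ρ.T q) (Real.log ((n : ℝ) / m) / (2 * π)) =
      weightHat w B (ρ.T q) 0 *
          ∑ n ∈ (Icc 1 ⌊lengthL q⌋₊).filter (fun n => Nat.Coprime n q), ρ.G q n ^ 2 / n +
        offDiagI0 w B ρ χ := by
  classical
  set N := ⌊lengthL q⌋₊ with hN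
  set F : ℕ → ℕ → ℝ := fun m n => ρ.coeff χ m * ρ.coeff χ n / Real.sqrt ((m : ℝ) * n) *
    weightHat w B (ρ.T q) (Real.log ((n : ℝ) / m) / (2 * π)) with hF
  have hsplit : ∀ m ∈ Icc 1 N, ∑ n ∈ Icc 1 N, F m n =
      F m m + ∑ n ∈ Icc 1 N, (if m = n then 0 else F m n) := by
    intro m hm
    have h1 : ∑ n ∈ Icc 1 N, F m n = ∑ n ∈ Icc 1 N, ((if m = n then F m n else 0) +
        (if m = n then 0 else F m n)) := by
      refine sum_congr rfl fun n _ => ?_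
      split_ifs <;> simp
    rw [h1, sum_add_distrib, sum_ite_eq]
    rw [if_pos hm]
  rw [sum_congr rfl hsplit, sum_add_distrib]
  congr 1
  -- the diagonal
  rw [mul_sum, sum_filter]
  refine sum_congr rfl fun m hm => ?_
  have hm1 : 1 ≤ m := (mem_Icc.mp hm).1
  have hm0 : (0 : ℝ) < m := by exact_mod_cast hm1
  simp only [hF]
  rw [div_self hm0.ne', Real.log_one, zero_div, show (m : ℝ) * m = (m : ℝ) ^ 2 by ring,
    Real.sqrt_sq hm0.le, ← sq, coeff_sq hχ]
  split_ifs <;> ring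

/-- **Theorem 3 from (15), the diagonal estimate and an off-diagonal bound** (§4 p. 12): if the
off-diagonal part of (15) is `o(S(q))` (`S(q) = Ŵ_T(0)(φ(q)/q) log L`) along moduli of primitive
quadratic characters, then `I₀ = (1 + o(1)) D_G Ŵ_T(0)(φ(q)/q) log L`. The diagonal contributes
`Ŵ_T(0)(D_G(φ/q) log L + O((log log q)²))` and `(log log q)² = o((φ(q)/q) log L)`; for `G₀ = 0` both
sides vanish. [cite: BondarenkoHeap2026, Theorem 3 (proof, §4 pp. 11–12)] -/
theorem theorem3_of_offDiagonal_aux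
    (h15 : ∀ (w : Bump) (B : ℕ) (ρ : Resonator) {q : ℕ}, 1 ≤ q → ∀ χ : DirichletCharacter ℂ q,
      I0R w B (ρ.coeff χ) (lengthL q) (ρ.T q) =
        ∑ m ∈ Icc 1 ⌊lengthL q⌋₊, ∑ n ∈ Icc 1 ⌊lengthL q⌋₊,
          ρ.coeff χ m * ρ.coeff χ n / Real.sqrt ((m : ℝ) * n) *
            weightHat w B (ρ.T q) (Real.log ((n : ℝ) / m) / (2 * π)))
    (hdiag : ∀ ρ : Resonator, ∃ K : ℝ, ∃ q₀ : ℕ, ∀ q : ℕ, q₀ ≤ q →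
      |(∑ n ∈ (Icc 1 ⌊lengthL q⌋₊).filter (fun n => Nat.Coprime n q), ρ.G q n ^ 2 / n) -
        dG ρ.G₀ * ((Nat.totient q : ℝ) / q) * Real.log (lengthL q)| ≤
          K * Real.log (Real.log q) ^ 2)
    (hll : ∀ (n : ℕ) {ε : ℝ}, 0 < ε → ∃ q₀ : ℕ, ∀ q : ℕ, q₀ ≤ q →
      Real.log (Real.log q) ^ n ≤ ε * Real.log q)
    (hOD : ∀ (w : Bump) (B : ℕ) (ρ : Resonator) (η : ℝ), 0 < η → ∃ q₀ : ℕ,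
      ∀ (q : ℕ) [NeZero q] (χ : DirichletCharacter ℂ q), q₀ ≤ q → χ.IsPrimitive → χ.IsQuadratic →
        |offDiagI0 w B ρ χ| ≤ η * scaleS w B ρ q) :
    theorem3 := by
  intro w B ρ η hη
  by_cases hG0 : ρ.G₀ = 0
  · -- everything vanishes
    refine ⟨1, fun q _ χ hq _ hχq => ?_⟩
    have hcoeff : ∀ n, ρ.coeff χ n = 0 := fun n => by
      rw [Resonator.coeff, Resonator.G, hG0, Polynomial.eval_zero, zero_mul, mul_zero]
    have hI0 : I0R w B (ρ.coeff χ) (lengthL q) (ρ.T q) = 0 := by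
      rw [h15 w B ρ hq χ]
      exact sum_eq_zero fun m _ => sum_eq_zero fun n _ => by rw [hcoeff m]; simp
    have hmain : I0main w B ρ q = 0 := by
      rw [I0main, hG0, dG]; simp
    rw [hI0, hmain]; simp
  · -- `D_G > 0`
    have hD : 0 < dG ρ.G₀ := Glue.dG_pos hG0
    obtain ⟨K, qd, hK⟩ := hdiag ρ
    set K₁ := max K 0 with hK₁
    have hK₁0 : 0 ≤ K₁ := le_max_right _ _
    obtain ⟨δφ, hδφ0, hδφ⟩ := MertensBound.exists_lt_totient_div_self
    obtain ⟨qW, hqW⟩ := weightHat_zero_lower cPhi_pos_holds weightHat_zero_holds w B ρ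
    have hCΦ : 0 < cPhi w B := cPhi_pos_holds w B
    obtain ⟨qA, hqA⟩ := hll 3 (ε := η * dG ρ.G₀ * δφ / (K₁ + 1)) (by positivity)
    obtain ⟨qO, hqO⟩ := hOD w B ρ (η * dG ρ.G₀ / 2) (by positivity)
    refine ⟨3 + qd + qW + qA + qO, fun q _ χ hq hχp hχq => ?_⟩
    have hq3 : 3 ≤ q := by omega
    have hq1 : 1 ≤ q := by omega
    have hKq := hK q (by omega)
    have hWlow := hqW q (by omega)
    have hA' := hqA q (by omega)
    have hO := hqO q χ (by omega) hχp hχq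
    -- positivity of the players
    have hq0 : (0 : ℝ) < q := by exact_mod_cast (show 0 < q by omega)
    have hq1r : (1 : ℝ) < q := by exact_mod_cast (show 1 < q by omega)
    have hq3r : (3 : ℝ) ≤ q := by exact_mod_cast hq3
    have hlogq1 : 1 < Real.log q :=
      lt_of_lt_of_le MertensBound.one_lt_log_three (Real.log_le_log (by norm_num) hq3r)
    have hlogq0 : 0 < Real.log q := lt_trans one_pos hlogq1
    have hll0 : 0 < Real.log (Real.log q) := Real.log_pos hlogq1
    set ll := Real.log (Real.log q) with hlldef
    set L := lengthL q with hL
    set T := ρ.T q with hT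
    have hlogL : Real.log L = 17 / 6 * Real.log q := by rw [hL, lengthL, Real.log_rpow hq0]
    have hlogL0 : 0 < Real.log L := by rw [hlogL]; positivity
    have hTq : (q : ℝ) ≤ T := le_T ρ hq1
    have hT0 : 0 < T := by linarith
    set W := weightHat w B T 0 with hWdef
    have hW0 : 0 < W := lt_of_lt_of_le (div_pos (mul_pos hCΦ hT0) two_pos) hWlow
    set Φq := (Nat.totient q : ℝ) / q with hΦq
    have hΦql : δφ / ll < Φq := hδφ q hq3
    have hΦq0 : 0 < Φq := lt_trans (div_pos hδφ0 hll0) hΦql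
    have hS : scaleS w B ρ q = W * Φq * Real.log L := rfl
    have hmain : I0main w B ρ q = dG ρ.G₀ * (W * Φq * Real.log L) := by
      rw [I0main]; ring
    -- the identity `I₀ − main = W · (diag − D Φ log L) + OD`
    set Dg := ∑ n ∈ (Icc 1 ⌊L⌋₊).filter (fun n => Nat.Coprime n q), ρ.G q n ^ 2 / n with hDg
    have hI : I0R w B (ρ.coeff χ) L T - I0main w B ρ q =
        W * (Dg - dG ρ.G₀ * Φq * Real.log L) + offDiagI0 w B ρ χ := by
      rw [h15 w B ρ hq1 χ, doubleSum_eq_diag_add_offDiag w B ρ hχq, hmain]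
      ring
    rw [hI]
    -- the diagonal error: `W K ll² ≤ (η/2) I0main`
    have hdiagb : |W * (Dg - dG ρ.G₀ * Φq * Real.log L)| ≤ η / 2 * I0main w B ρ q := by
      rw [abs_mul, abs_of_pos hW0, hmain]
      have h1 : |Dg - dG ρ.G₀ * Φq * Real.log L| ≤ K₁ * ll ^ 2 :=
        hKq.trans (mul_le_mul_of_nonneg_right (le_max_left _ _) (sq_nonneg _))
      have h2 : K₁ * ll ^ 2 ≤ η / 2 * (dG ρ.G₀ * (Φq * Real.log L)) := by
        -- from `ll³ ≤ ε log q`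
        have hKp : (0 : ℝ) < K₁ + 1 := by linarith
        have h3 : (K₁ + 1) * ll ^ 3 ≤ η * dG ρ.G₀ * δφ * Real.log q := by
          have := mul_le_mul_of_nonneg_left hA' hKp.le
          rw [div_mul_eq_mul_div, mul_div_assoc', mul_div_cancel_left₀ _ hKp.ne'] at this
          exact this
        have h4 : K₁ * ll ^ 3 ≤ η * dG ρ.G₀ * δφ * Real.log q := by
          have : 0 ≤ ll ^ 3 := by positivity
          linarith
        have h5 : K₁ * ll ^ 2 ≤ η * dG ρ.G₀ * (δφ / ll) * Real.log q := by
          rw [show η * dG ρ.G₀ * (δφ / ll) * Real.log q = η * dG ρ.G₀ * δφ * Real.log q / ll by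
            field_simp]
          rw [le_div_iff₀ hll0]
          calc K₁ * ll ^ 2 * ll = K₁ * ll ^ 3 := by ring
            _ ≤ _ := h4
        have h6 : η * dG ρ.G₀ * (δφ / ll) * Real.log q ≤ η / 2 * (dG ρ.G₀ * (Φq * Real.log L)) := by
          rw [hlogL]
          have : δφ / ll * Real.log q ≤ Φq * Real.log q :=
            mul_le_mul_of_nonneg_right hΦql.le hlogq0.le
          have h7 := mul_le_mul_of_nonneg_left this (by positivity : (0 : ℝ) ≤ η * dG ρ.G₀)
          nlinarith [h7, hΦq0, hlogq0, hD, hη]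
        exact h5.trans h6
      calc W * |Dg - dG ρ.G₀ * Φq * Real.log L| ≤ W * (K₁ * ll ^ 2) :=
            mul_le_mul_of_nonneg_left h1 hW0.le
        _ ≤ W * (η / 2 * (dG ρ.G₀ * (Φq * Real.log L))) := mul_le_mul_of_nonneg_left h2 hW0.le
        _ = η / 2 * (dG ρ.G₀ * (W * Φq * Real.log L)) := by ring
    have hODb : |offDiagI0 w B ρ χ| ≤ η / 2 * I0main w B ρ q := by
      refine hO.trans (le_of_eq ?_)
      rw [hS, hmain]; ring
    have hmain0 : 0 ≤ I0main w B ρ q := by rw [hmain]; positivity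
    calc |W * (Dg - dG ρ.G₀ * Φq * Real.log L) + offDiagI0 w B ρ χ|
        ≤ η / 2 * I0main w B ρ q + η / 2 * I0main w B ρ q :=
          (abs_add_le _ _).trans (add_le_add hdiagb hODb)
      _ = η * I0main w B ρ q := by ring

/-- **Theorem 3 ⇐ its off-diagonal estimate.** With (15) (`eq15`), the diagonal
(`diagonal_I0_estimate`) and (3) (`Section2Proofs`) all PROVED, BH26:Thm3 is reduced to the single
printed claim "the off-diagonal is `≪ q^ε(L/q + √q log(2L)) = o(T)`" (§4 p. 12, last display), here in
the weaker form `offDiagI0 = o(S(q))` along moduli of primitive quadratic characters, taken as an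
explicit hypothesis (no named fact is introduced). [cite: BondarenkoHeap2026, Theorem 3 (proof, §4 pp. 11–12)] -/
theorem theorem3_of_offDiagonal
    (hOD : ∀ (w : Bump) (B : ℕ) (ρ : Resonator) (η : ℝ), 0 < η → ∃ q₀ : ℕ,
      ∀ (q : ℕ) [NeZero q] (χ : DirichletCharacter ℂ q), q₀ ≤ q → χ.IsPrimitive → χ.IsQuadratic →
        |offDiagI0 w B ρ χ| ≤ η * scaleS w B ρ q) :
    theorem3 :=
  theorem3_of_offDiagonal_aux (fun w B ρ _ hq χ => eq15 w B ρ hq χ) diagonal_I0_estimate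
    (fun n _ hε => exists_loglog_pow_le n hε) hOD

/-- **Bondarenko–Heap Theorem 1 from the leaves left after §§3–5** (bookkeeping corollary of the
sibling `bondarenkoHeap2026_theorem1_of_internal`): Proposition 1 (RH-conditional explicit formula),
the off-diagonal estimate of Theorem 3's proof (explicit hypothesis), Proposition 3 (Heath-Brown) and
Proposition 6 (the off-diagonal of `J`, §6) imply `bondarenkoHeap2026_theorem1`; Theorem 3's diagonal
and (15), Theorem 4 ⇐ Prop 5 + Prop 6, Prop 5 ⇐ (17) + (18) + Prop 3, (3), the extension to `ℝ`
(`extensionToLine_holds`) and the numerical inequality (8) (`numericalInequality8_holds`) being kernel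
theorems of this file and its siblings. NOT RH-BEARING: an implication between printed claims; nothing
here asserts RH, Siegel zeros or the antecedents. [claim: BondarenkoHeap2026, status: under-review] -/
theorem bondarenkoHeap2026_theorem1_of_leaves (h1 : proposition1)
    (hOD : ∀ (w : Bump) (B : ℕ) (ρ : Resonator) (η : ℝ), 0 < η → ∃ q₀ : ℕ,
      ∀ (q : ℕ) [NeZero q] (χ : DirichletCharacter ℂ q), q₀ ≤ q → χ.IsPrimitive → χ.IsQuadratic →
        |offDiagI0 w B ρ χ| ≤ η * scaleS w B ρ q)
    (h3 : prop3) (h6 : prop6) : bondarenkoHeap2026_theorem1 :=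
  bondarenkoHeap2026_theorem1_of_internal h1 (theorem3_of_offDiagonal hOD)
    (theorem4_of_prop3_prop6 h3 h6) cPhi_pos_holds weightHat_zero_holds extensionToLine_holds
    numericalInequality8_holds

end Theorem3Glue

end Literature.NumberTheory.LFunctions.BondarenkoHeap2026
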